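import Literature.MathematicalPhysics.QuantumFieldTheory.Chatterjee2019LargeN.UnitLoops
import Literature.MathematicalPhysics.QuantumFieldTheory.Chatterjee2019LargeN.AreaParity
import Literature.MathematicalPhysics.QuantumFieldTheory.StrongCouplingEuclidean
import HarnessLib

/-!
# Chatterjee 2019, §4: the third-order strong-coupling coefficient of the plaquette, `a₃((p)) = 0`

S. Chatterjee, *Rigorous solution of strongly coupled SO(N) lattice gauge theory in the large N limit*,
Comm. Math. Phys. 366 (2019) [cite: Chatterjee2019LargeN, §4, §2.2, Corollary 10.4, Lemma 11.3, §14].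

§4 (last paragraph) lists the first strong-coupling coefficients of the Wilson loop expectation of a single
plaquette `p`: «`a₀ = 0`, `a₁ = 1`, `a₂ = 0`, `a₃ = 0`, `a₄ = 0` …», obtained in the source by running the
recursive algorithm of Corollary 10.4 (the first-move recursion `|s|·a_k(s) = Σ_{𝕊⁻} a_k − Σ_{𝕊⁺} a_k +
Σ_{𝔻⁻} a_{k−1} − Σ_{𝔻⁺} a_{k−1}`, `WilsonLoopFactorization.len_mul_coeffA`). Rows `k = 0, 1, 2, 4` are the theorems
`plaquetteCoefficientsZ3_zero/_one/_two/_four` (`AreaLowerBound`, `PlaquetteFirstOrder`, `AreaParity`). This file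
proves the row `k = 3` — ★ `coeffA_plaquette_three : a₃((p)) = 0` for every plaquette of `ℤᵈ`, every `d` — by
carrying out the recursion by hand, and packages rows `k ≤ 4` as `plaquetteCoefficientsZ3_of_lt_five`.

## The computation (following §4's algorithm literally)
For `s = (∂p)` the splitting sets `𝕊^±((∂p))` are empty (the four letters of `∂p` lie on distinct edges), so
`4·a₃((∂p)) = Σ_{x, q' ∈ 𝒫⁺(e_x)} [a₂((∂p ⊖ₓ q')) − a₂((∂p ⊕ₓ q'))]` (`deform_terms_cancel` shows each bracket is `0`).
Read `∂p` from the location `x` as a unit loop `P = e b₂ b₃ b₄` (`UnitLoops.IsUnitLoop`); a plaquette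
`q' ∈ 𝒫⁺(e)`, `q' ≠ p`, has a unit loop `Q = e c₂ c₃ c₄` through the same letter (`exists_unit_cons`), and the
seven undirected edges of `P, Q` are pairwise distinct (`distinct`, from `StrongCouplingEuclidean.eq_of_two_links`:
two plaquettes sharing two edges are equal). Then (§2.2's formulas, `UnitLoops.IsUnitLoop.negDeform_eq/posDeform_eq`):
* `∂p ⊖ₓ p = ∅` (`a₂ = 0`) and `∂p ⊕ₓ p = V V`, the doubled loop (`posDeform_V_p`);
* `∂p ⊖ₓ q' = w₆ = c₄⁻¹ c₃⁻¹ c₂⁻¹ b₂ b₃ b₄` (`negDeform_P_q`) and `∂p ⊕ₓ q' = w₈ = e c₂ c₃ c₄ e b₂ b₃ b₄` (`posDeform_P_q`).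
The three order-`2` coefficients are evaluated by the same recursion at `k = 2`, whose right-hand side only
involves `a₂` of PAIRS produced by splittings — `a₂((u₁, u₂)) = 1` for two unit loops (`UnitLoops.coeffA_pair_two`,
Lemma 11.3's factorisation) — and `a₁` of single loops, which is `1` for a unit loop (`IsUnitLoop.coeffA_one`, §4
«a₁ = 1») and `0` for a loop whose 1-chain is not `±δq''` (`UnitLoops.coeffA_singleton_one_eq_zero_of_wordChain`,
§14's area bound at `k = 1`); the 1-chains are tracked by `r(l ⊖ q) = r(l) − r(∂q)`, `r(l ⊕ q) = r(l) + r(∂q)`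
(§14, proof of Lemma 14.1) and the elementary facts `mem_pair_of_chain_eq`, `chain_ne_of_double`,
`eq_of_chain_double`, `chain_ne_of_triple` on `ℤ`-combinations of at most three plaquette chains:
* ★ `coeffA_w6_two : a₂(w₆) = 1` — `6·a₂ = 0 − 0 + (6 − 0)`: no splittings (`letters_w6`); the six negative
  deformations back to a unit loop (`w₆ ⊖ q = P` at the three `q`-letters, `w₆ ⊖ p = e⁻¹c₄⁻¹c₃⁻¹c₂⁻¹` at the three
  `p`-letters: `negDeform_w6_0…5`) have `a₁ = 1`, all other deformations have 1-chain `±δp ± δq ± δq'` or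
  `δp − 2δq`, `2δp − δq` (`eval_neg_w6`, `eval_pos_w6`).
* ★ `coeffA_w8_two : a₂(w₈) = 1` — `8·a₂ = 0 − 2 + (10 − 0)`: the two positive splittings at the repeated letter
  `e` give `(P, c₂c₃c₄e)` and `(Q, b₂b₃b₄e)` (`sameIdx_w8`, `a₂ = 1` each); ten negative deformations give unit
  loops (the own plaquette at each of the `8` letters, and additionally the other plaquette at the two `e`'s:
  `negDeform_w8_*`, `eval_neg_w8`); positive deformations vanish (`eval_pos_w8`).
* ★ `coeffA_double_two : a₂(V V) = 0` — `8·a₂ = 0 − 8 + (8 − 0)`: the eight antipodal splittings `(x, x ± 4)` give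
  two unit loops each (`sameIdx_double`), the eight deformations `V V ⊖ₓ p` give a unit loop each (`eval_neg_double`),
  everything else has 1-chain `2δp ± δq'` or `3δp` (`eval_pos_double`).
Hence every bracket is `0 − 0` or `1 − 1`, and `a₃((p)) = 0` (★ `coeffA_plaquette_three`, `plaquetteCoefficientsZ3_three`).
* (v1.1) `plaquetteExpansion_order_five_of_realAnalyticity`: with Corollary 3.5 (`RealAnalyticityStrongCoupling d`) and rows `k ≤ 4`,
  `lim ⟨W_p⟩/N = β + O(β⁵)` in every `d ≥ 2` — §4's last display to the order verified here (the argument of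
  `MasterLoopEquation.plaquetteExpansionZ3_of` with `6 ↦ 5`; independent of the row `k = 5`).

Technical lemmas: backtrack erasure of interior/terminal backtracks (`red_cancel_middle`, `core_conj`, §2.1),
invariance of deformations/splittings under re-reading a loop from another location (`negDeform_eq_of_rotate_eq`,
`posSplit_eq_of_rotate_eq`), and the bookkeeping of the index types `𝔻((w))`, `𝕊^±((w))` of a one-loop sequence
(`deformIdx_elim`, `sameIdx_elim`, `invIdx_isEmpty`, `sameIdx_isEmpty`). No new definitions, no named facts.

## WHAT THIS IS NOT
Only the coefficient `a₃` of the `1/N → 0` strong-coupling series of Corollary 3.5 for a single plaquette is computed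
(plus the packaging of rows `k ≤ 4`); the row `k = 5` of `PlaquetteCoefficientsZ3` («`a₅ = −7`», a computer
enumeration in the source) is not addressed, nor is `PlaquetteExpansionZ3`. Nothing here concerns finite `N`,
four-dimensional Yang–Mills, or a mass gap.
-/

noncomputable section

open Finset
open Literature.Probability.LatticeModels Literature.MathematicalPhysics.QuantumLattice

namespace Literature.MathematicalPhysics.QuantumFieldTheory.Chatterjee2019LargeN

variable {d : ℕ}

namespace PlaquetteThirdOrderProof

/-! ### Backtrack erasure: `core` along free reductions and of reduced conjugates -/

/-- Backtrack erasure is insensitive to prior interior erasures: `[ρ] = [ρ']` when `ρ` erases to `ρ'`.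
[cite: Chatterjee2019LargeN, §2.1 (Lemma 2.1: the core does not depend on the erasure sequence)] -/
theorem core_eq_of_red {L₁ L₂ : Word d} (h : FreeGroup.Red L₁ L₂) : core L₁ = core L₂ := by
  unfold core
  rw [FreeGroup.reduce.eq_of_red h]

/-- An interior backtrack `m⁻¹ m` between `A` and `B` erases. [cite: Chatterjee2019LargeN, §2.1 (backtrack erasure)] -/
theorem red_cancel_middle (A M B : Word d) : FreeGroup.Red (A ++ FreeGroup.invRev M ++ M ++ B) (A ++ B) := by
  have h := FreeGroup.Red.append_append (FreeGroup.Red.append_append (FreeGroup.Red.refl (L := A))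
    (red_invRev_append_self M)) (FreeGroup.Red.refl (L := B))
  simpa only [List.append_assoc, List.append_nil] using h

/-- An interior backtrack `m m⁻¹` between `A` and `B` erases. [cite: Chatterjee2019LargeN, §2.1 (backtrack erasure)] -/
theorem red_cancel_middle' (A M B : Word d) : FreeGroup.Red (A ++ M ++ FreeGroup.invRev M ++ B) (A ++ B) := by
  have h := red_cancel_middle A (FreeGroup.invRev M) B
  rwa [FreeGroup.invRev_invRev] at h

/-- A loop is its own cyclic reduction. [cite: Chatterjee2019LargeN, §2.1 ([l] = l for a loop)] -/
theorem reduceCyclically_eq_of_isLoop {m : Word d} (hm : IsLoop m) : FreeGroup.reduceCyclically m = m := by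
  have h := hm.core_eq
  rwa [core, hm.2.isReduced.reduce_eq] at h

/-- **Terminal backtrack erasure of a reduced conjugate**: if `c⁻¹ m c` has no interior backtrack and `m` is a loop,
its core is `m` (the `|c|` terminal backtracks erase one by one). [cite: Chatterjee2019LargeN, §2.1 (terminal backtracks, the core)] -/
theorem core_conj {m : Word d} (hm : IsLoop m) :
    ∀ c : Word d, FreeGroup.IsReduced (FreeGroup.invRev c ++ m ++ c) → core (FreeGroup.invRev c ++ m ++ c) = m := by
  intro c
  induction c using List.reverseRecOn with
  | nil =>
    intro _
    simpa [FreeGroup.invRev] using hm.core_eq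
  | append_singleton c z ih =>
    intro hred
    have hshape : FreeGroup.invRev (c ++ [z]) ++ m ++ (c ++ [z])
        = DEdge.inv z :: ((FreeGroup.invRev c ++ m ++ c) ++ [z]) := by
      simp [FreeGroup.invRev, DEdge.inv, List.append_assoc]
    have hred' : FreeGroup.IsReduced (FreeGroup.invRev c ++ m ++ c) := by
      rw [hshape] at hred
      exact hred.infix ⟨[DEdge.inv z], [z], by simp [List.append_assoc]⟩
    rw [core, hred.reduce_eq, hshape, FreeGroup.reduceCyclically.cons_append, if_pos (by simp [DEdge.inv])]
    have := ih hred'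
    rwa [core, hred'.reduce_eq] at this

/-! ### Reducedness and closedness of explicit words -/

/-- A word whose consecutive letters lie on different undirected edges, and whose last and first letters do as well,
is nonbacktracking. [cite: Chatterjee2019LargeN, §2.1 (backtracks eᵢ₊₁ = eᵢ⁻¹ share the undirected edge)] -/
theorem isCyclicallyReduced_of_fst_ne {l : Word d} (h1 : l.IsChain fun a b => a.1 ≠ b.1)
    (h2 : ∀ a ∈ l.getLast?, ∀ b ∈ l.head?, a.1 ≠ b.1) : FreeGroup.IsCyclicallyReduced l := by
  exact ⟨List.IsChain.imp (fun _ _ hab h => absurd h hab) h1, fun a ha b hb hab => absurd hab (h2 a ha b hb)⟩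

/-- A word whose consecutive letters lie on different undirected edges is reduced. [cite: Chatterjee2019LargeN, §2.1] -/
theorem isReduced_of_fst_ne {l : Word d} (h1 : l.IsChain fun a b => a.1 ≠ b.1) : FreeGroup.IsReduced l :=
  List.IsChain.imp (fun _ _ hab h => absurd h hab) h1

/-! ### 1-chains of plaquettes on edges; a free edge of `p` -/

/-- `δq(f) = 0` off the edges of `q`. [cite: Chatterjee2019LargeN, §3 (δp = e₁ + e₂ − e₃ − e₄)] -/
theorem plaquetteChain_apply_eq_zero {q : ZdPlaquette d} {f : ZdEdge d} (hf : f ∉ plaquetteEdges q) :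
    plaquetteChain q f = 0 := by
  by_contra h
  exact hf (PlaquetteFirstOrderProof.plaquetteChain_apply_ne_zero h)

/-- `δp(f) = ±1` on the edges of `p`. [cite: Chatterjee2019LargeN, §3 (δp = e₁ + e₂ − e₃ − e₄)] -/
theorem plaquetteChain_apply_of_mem {p : ZdPlaquette d} {f : ZdEdge d} (hf : f ∈ plaquetteEdges p) :
    plaquetteChain p f = 1 ∨ plaquetteChain p f = -1 := by
  obtain ⟨x, ⟨⟨i, j⟩, hij⟩⟩ := p
  have hne : i ≠ j := ne_of_lt hij
  have h1 : ∀ k : Fin d, x + Pi.single k (1 : ℤ) ≠ x := fun k h => by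
    have := congrFun h k; simp at this
  have h2 : ∀ k : Fin d, x ≠ x + Pi.single k (1 : ℤ) := fun k h => h1 k h.symm
  have h3 : x + Pi.single j (1 : ℤ) ≠ x + Pi.single i 1 := fun h => by
    have := congrFun (add_left_cancel h) i
    simp [hne] at this
  have h3' : x + Pi.single i (1 : ℤ) ≠ x + Pi.single j 1 := fun h => h3 h.symm
  simp only [plaquetteEdges, Finset.mem_insert, Finset.mem_singleton] at hf
  rcases hf with rfl | rfl | rfl | rfl <;>
    simp [plaquetteChain, wordChain, plaquetteWord, edgeChain, hne, hne.symm, h1, h2, h3, h3']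

/-- Distinct plaquettes share at most one edge. [cite: Chatterjee2019LargeN, §2.1 (plaquettes of ℤᵈ)] -/
theorem card_inter_plaquetteEdges_le_one {p q : ZdPlaquette d} (hpq : q ≠ p) :
    (plaquetteEdges p ∩ plaquetteEdges q).card ≤ 1 := by
  rw [Finset.card_le_one]
  intro f hf g hg
  rw [Finset.mem_inter] at hf hg
  by_contra hne
  exact hpq (eq_of_two_links hne hf.1 hg.1 hf.2 hg.2).symm

/-- A plaquette has four edges. [cite: Chatterjee2019LargeN, §2.1 (a plaquette is a closed path of length four)] -/
theorem four_le_card_plaquetteEdges (p : ZdPlaquette d) : 4 ≤ (plaquetteEdges p).card := by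
  classical
  have h1 : (((plaquetteWord p).map Prod.fst).toFinset).card = 4 := by
    rw [List.toFinset_card_of_nodup (plaquetteWord_map_fst_nodup p), List.length_map, length_plaquetteWord]
  rw [← h1]
  refine Finset.card_le_card fun f hf => ?_
  rw [List.mem_toFinset, List.mem_map] at hf
  obtain ⟨a, ha, rfl⟩ := hf
  exact fst_mem_plaquetteEdges_of_mem ha

/-- **A free edge**: given at most three plaquettes other than `p`, some edge of `p` lies in none of them.
[cite: Chatterjee2019LargeN, §2.1 (plaquettes of ℤᵈ: distinct plaquettes share at most one edge)] -/
theorem exists_free_edge (p : ZdPlaquette d) (S : Finset (ZdPlaquette d)) (hS : ∀ q ∈ S, q ≠ p) (hcard : S.card ≤ 3) :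
    ∃ f ∈ plaquetteEdges p, ∀ q ∈ S, f ∉ plaquetteEdges q := by
  classical
  by_contra hcon
  -- every edge of `p` is covered by some `q ∈ S`
  have hcov : plaquetteEdges p ⊆ S.biUnion fun q => plaquetteEdges p ∩ plaquetteEdges q := by
    intro f hf
    by_contra hf'
    refine hcon ⟨f, hf, fun q hq hfq => hf' ?_⟩
    exact Finset.mem_biUnion.2 ⟨q, hq, Finset.mem_inter.2 ⟨hf, hfq⟩⟩
  have h1 := Finset.card_le_card hcov
  have h2 : (S.biUnion fun q => plaquetteEdges p ∩ plaquetteEdges q).card ≤ S.card * 1 :=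
    Finset.card_biUnion_le_card_mul _ _ _ fun q hq => card_inter_plaquetteEdges_le_one (hS q hq)
  have h3 := four_le_card_plaquetteEdges p
  omega

/-! ### Chain lemmas: which combinations of `δp`, `δq` are (signed) plaquette chains -/

/-- `τ'Q + σQ' = 0` with `τ' = ±1` gives `Q = −τ'σ Q'`. [cite: Chatterjee2019LargeN, §3 (the free ℤ-module of 1-chains)] -/
theorem eq_smul_of_add_eq_zero {τ' σ : ℤ} (hτ' : τ' = 1 ∨ τ' = -1) {Q Q' : ZdEdge d →₀ ℤ}
    (h : τ' • Q + σ • Q' = 0) : Q = (-(τ' * σ)) • Q' := by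
  have hτ2 : τ' * τ' = 1 := by rcases hτ' with rfl | rfl <;> norm_num
  have h2 := congrArg (fun c => τ' • c) h
  simp only [smul_add, smul_smul, hτ2, one_smul, smul_zero] at h2
  rw [neg_smul]
  exact eq_neg_of_add_eq_zero_left h2

/-- Evaluating at an edge: the value of `τδp` at an edge `f` of `p` is `±τ`. [cite: Chatterjee2019LargeN, §3] -/
theorem smul_plaquetteChain_apply_of_mem {p : ZdPlaquette d} {f : ZdEdge d} (hf : f ∈ plaquetteEdges p) (τ : ℤ) :
    (τ • plaquetteChain p) f = τ ∨ (τ • plaquetteChain p) f = -τ := by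
  rcases plaquetteChain_apply_of_mem hf with h | h <;> simp [Finsupp.smul_apply, h]

/-- … and `τδq` vanishes at edges off `q`. [cite: Chatterjee2019LargeN, §3] -/
theorem smul_plaquetteChain_apply_of_not_mem {q : ZdPlaquette d} {f : ZdEdge d} (hf : f ∉ plaquetteEdges q) (τ : ℤ) :
    (τ • plaquetteChain q) f = 0 := by
  simp [Finsupp.smul_apply, plaquetteChain_apply_eq_zero hf]

/-- `τδp + τ'δq + σδq' = ρδq''` with `p ≠ q` (unit `τ, τ', σ`, any integer `ρ`) forces `q' ∈ {p, q}`. [cite: Chatterjee2019LargeN, §14 (r-bookkeeping), §3 (δ)] -/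
theorem mem_pair_of_chain_eq {p q q' q'' : ZdPlaquette d} (hpq : p ≠ q) {τ τ' σ : ℤ} (hτ : τ = 1 ∨ τ = -1)
    (hτ' : τ' = 1 ∨ τ' = -1) (hσ : σ = 1 ∨ σ = -1) (ρ : ℤ)
    (h : τ • plaquetteChain p + τ' • plaquetteChain q + σ • plaquetteChain q' = ρ • plaquetteChain q'') :
    q' = p ∨ q' = q := by
  classical
  by_contra hq'
  obtain ⟨hq'p, hq'q⟩ := not_or.1 hq'
  by_cases hq'' : q'' = p
  · rw [hq''] at h
    by_cases hτρ : τ = ρ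
    · rw [← hτρ, add_assoc] at h
      have h0 : τ' • plaquetteChain q + σ • plaquetteChain q' = 0 := add_left_cancel (h.trans (add_zero _).symm)
      have h2 := eq_smul_of_add_eq_zero hτ' h0
      exact hq'q (PlaquetteFirstOrderProof.eq_of_plaquetteChain_eq_smul
        (by rcases hτ' with rfl | rfl <;> rcases hσ with rfl | rfl <;> simp) h2).symm
    · -- evaluate at an edge of `p` outside `q` and `q'`
      obtain ⟨f, hf, hfree⟩ := exists_free_edge p {q, q'} (by
        intro r hr; simp only [Finset.mem_insert, Finset.mem_singleton] at hr
        rcases hr with rfl | rfl; exacts [hpq.symm, hq'p]) ((Finset.card_insert_le _ _).trans (by simp))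
      have e := congrArg (fun c => c f) h
      simp only [Finsupp.add_apply, smul_plaquetteChain_apply_of_not_mem (hfree q (by simp)),
        smul_plaquetteChain_apply_of_not_mem (hfree q' (by simp)), add_zero, Finsupp.smul_apply, smul_eq_mul] at e
      rcases plaquetteChain_apply_of_mem hf with h1 | h1 <;> rw [h1] at e <;> omega
  · obtain ⟨f, hf, hfree⟩ := exists_free_edge p {q, q', q''} (by
      intro r hr; simp only [Finset.mem_insert, Finset.mem_singleton] at hr
      rcases hr with rfl | rfl | rfl; exacts [hpq.symm, hq'p, hq'']) ((Finset.card_insert_le _ _).trans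
        (Nat.succ_le_succ ((Finset.card_insert_le _ _).trans (by simp))))
    have e := congrArg (fun c => c f) h
    simp only [Finsupp.add_apply, smul_plaquetteChain_apply_of_not_mem (hfree q (by simp)),
      smul_plaquetteChain_apply_of_not_mem (hfree q' (by simp)),
      smul_plaquetteChain_apply_of_not_mem (hfree q'' (by simp)), add_zero] at e
    rcases smul_plaquetteChain_apply_of_mem hf τ with h1 | h1 <;> rcases hτ with rfl | rfl
    all_goals (rw [h1] at e; omega)

/-- `τδp + 2τ'δq ≠ ρδq''` for `p ≠ q` (any integer `ρ`). [cite: Chatterjee2019LargeN, §14, §3] -/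
theorem chain_ne_of_double {p q q'' : ZdPlaquette d} (hpq : p ≠ q) {τ τ' : ℤ} (hτ : τ = 1 ∨ τ = -1)
    (hτ' : τ' = 1 ∨ τ' = -1) (ρ : ℤ) :
    τ • plaquetteChain p + (2 * τ') • plaquetteChain q ≠ ρ • plaquetteChain q'' := by
  classical
  intro h
  by_cases hq'' : q'' = q
  · rw [hq''] at h
    obtain ⟨f, hf, hfree⟩ := exists_free_edge p {q} (by simpa using hpq.symm) (by simp)
    have e := congrArg (fun c => c f) h
    simp only [Finsupp.add_apply, smul_plaquetteChain_apply_of_not_mem (hfree q (by simp)), add_zero] at e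
    rcases smul_plaquetteChain_apply_of_mem hf τ with h1 | h1 <;> rcases hτ with rfl | rfl
    all_goals (rw [h1] at e; omega)
  · obtain ⟨f, hf, hfree⟩ := exists_free_edge q {p, q''} (by
      intro r hr; simp only [Finset.mem_insert, Finset.mem_singleton] at hr
      rcases hr with rfl | rfl; exacts [hpq, hq'']) ((Finset.card_insert_le _ _).trans (by simp))
    have e := congrArg (fun c => c f) h
    simp only [Finsupp.add_apply, smul_plaquetteChain_apply_of_not_mem (hfree p (by simp)),
      smul_plaquetteChain_apply_of_not_mem (hfree q'' (by simp)), zero_add] at e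
    rcases smul_plaquetteChain_apply_of_mem hf (2 * τ') with h1 | h1 <;> rcases hτ' with rfl | rfl
    all_goals (rw [h1] at e; omega)

/-- `2τδp + σδq' = ρδq''` forces `q' = p`. [cite: Chatterjee2019LargeN, §14, §3] -/
theorem eq_of_chain_double {p q' q'' : ZdPlaquette d} {τ σ ρ : ℤ} (hτ : τ = 1 ∨ τ = -1) (hσ : σ = 1 ∨ σ = -1)
    (hρ : ρ = 1 ∨ ρ = -1) (h : (2 * τ) • plaquetteChain p + σ • plaquetteChain q' = ρ • plaquetteChain q'') :
    q' = p := by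
  classical
  by_contra hq'
  by_cases hq'' : q'' = p
  · rw [hq''] at h
    -- `(2τ − ρ)δp + σδq' = 0` with `2τ − ρ ∈ {±1, ±3}`; only `±1` survives, forcing `q' = p`
    have h0 : (2 * τ - ρ) • plaquetteChain p + σ • plaquetteChain q' = 0 := by
      rw [sub_smul, sub_add_eq_add_sub, h, sub_self]
    obtain ⟨f, hf, hfree⟩ := exists_free_edge p {q'} (by simpa using hq') (by simp)
    have e := congrArg (fun c => c f) h0
    simp only [Finsupp.add_apply, smul_plaquetteChain_apply_of_not_mem (hfree q' (by simp)), add_zero,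
      Finsupp.coe_zero, Pi.zero_apply] at e
    have hcoef : 2 * τ - ρ = 1 ∨ 2 * τ - ρ = -1 := by
      rcases smul_plaquetteChain_apply_of_mem hf (2 * τ - ρ) with h1 | h1 <;> rcases hτ with rfl | rfl <;>
        rcases hρ with rfl | rfl
      all_goals (rw [h1] at e; omega)
    have h3 := eq_smul_of_add_eq_zero hcoef h0
    exact hq' (PlaquetteFirstOrderProof.eq_of_plaquetteChain_eq_smul
      (by rcases hcoef with hc | hc <;> rw [hc] <;> rcases hσ with rfl | rfl <;> simp) h3).symm
  · obtain ⟨f, hf, hfree⟩ := exists_free_edge p {q', q''} (by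
      intro r hr; simp only [Finset.mem_insert, Finset.mem_singleton] at hr
      rcases hr with rfl | rfl; exacts [hq', hq'']) ((Finset.card_insert_le _ _).trans (by simp))
    have e := congrArg (fun c => c f) h
    simp only [Finsupp.add_apply, smul_plaquetteChain_apply_of_not_mem (hfree q' (by simp)),
      smul_plaquetteChain_apply_of_not_mem (hfree q'' (by simp)), add_zero] at e
    rcases smul_plaquetteChain_apply_of_mem hf (2 * τ) with h1 | h1 <;> rcases hτ with rfl | rfl
    all_goals (rw [h1] at e; omega)

/-- `3τδp ≠ ρδq''`. [cite: Chatterjee2019LargeN, §14, §3] -/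
theorem chain_ne_of_triple {p q'' : ZdPlaquette d} {τ ρ : ℤ} (hτ : τ = 1 ∨ τ = -1) (hρ : ρ = 1 ∨ ρ = -1) :
    (3 * τ) • plaquetteChain p ≠ ρ • plaquetteChain q'' := by
  classical
  intro h
  by_cases hq'' : q'' = p
  · rw [hq''] at h
    have e := congrArg (fun c => c (p.1, p.2.1.2)) h
    simp only [Finsupp.smul_apply, smul_eq_mul, plaquetteChain_apply_fst, mul_one] at e
    rcases hτ with rfl | rfl <;> rcases hρ with rfl | rfl <;> omega
  · obtain ⟨f, hf, hfree⟩ := exists_free_edge p {q''} (by simpa using hq'') (by simp)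
    have e := congrArg (fun c => c f) h
    simp only [smul_plaquetteChain_apply_of_not_mem (hfree q'' (by simp))] at e
    rcases smul_plaquetteChain_apply_of_mem hf (3 * τ) with h1 | h1 <;> rcases hτ with rfl | rfl
    all_goals (rw [h1] at e; omega)

/-! ### Two adjacent plaquettes: unit loops `P = e b₂ b₃ b₄` of `p` and `Q = e c₂ c₃ c₄` of `q ≠ p` through the same oriented edge `e` -/

section TwoPlaquettes

variable {p q : ZdPlaquette d} {e b₂ b₃ b₄ c₂ c₃ c₄ : DEdge d}

/-- `q' ∈ 𝒫⁺(f)` iff the undirected edge of `f` is an edge of `q'`. [cite: Chatterjee2019LargeN, §2.2 (𝒫⁺(e))] -/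
theorem mem_plaquettesAt_iff {q' : ZdPlaquette d} {f : DEdge d} : q' ∈ plaquettesAt f ↔ f.1 ∈ plaquetteEdges q' := by
  rw [plaquettesAt, mem_plaquettesTouching_iff]
  constructor
  · rintro ⟨g, hg⟩
    rw [Finset.mem_inter, Finset.mem_singleton] at hg
    exact hg.2 ▸ hg.1
  · intro h
    exact ⟨f.1, Finset.mem_inter.2 ⟨h, Finset.mem_singleton_self _⟩⟩

/-- The undirected edges of a unit loop written `[a₁, a₂, a₃, a₄]` are pairwise distinct. [cite: Chatterjee2019LargeN, §2.2] -/
theorem fst_ne_of_unit {q' : ZdPlaquette d} {a₁ a₂ a₃ a₄ : DEdge d} (h : IsUnitLoop q' [a₁, a₂, a₃, a₄]) :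
    (a₁.1 ≠ a₂.1 ∧ a₁.1 ≠ a₃.1 ∧ a₁.1 ≠ a₄.1) ∧ (a₂.1 ≠ a₃.1 ∧ a₂.1 ≠ a₄.1) ∧ a₃.1 ≠ a₄.1 := by
  have hn := h.map_fst_nodup
  simp only [List.map_cons, List.map_nil, List.nodup_cons, List.mem_cons, List.not_mem_nil, or_false,
    not_or, List.nodup_nil, and_true, not_false_eq_true] at hn
  exact ⟨hn.1, hn.2.1, hn.2.2⟩

/-- **The two plaquettes share only the edge of `e`**: an edge of `P` other than `e` is not an edge of `q`.
[cite: Chatterjee2019LargeN, §2.1 (plaquettes of ℤᵈ)] -/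
theorem fst_not_mem_of_two_units (hP : IsUnitLoop p [e, b₂, b₃, b₄]) (hQ : IsUnitLoop q [e, c₂, c₃, c₄]) (hpq : p ≠ q)
    {b : DEdge d} (hb : b = b₂ ∨ b = b₃ ∨ b = b₄) : b.1 ∉ plaquetteEdges q := by
  intro hbq
  have hbP : b ∈ [e, b₂, b₃, b₄] := by rcases hb with rfl | rfl | rfl <;> simp
  have hbp : b.1 ∈ plaquetteEdges p := hP.fst_mem_plaquetteEdges hbP
  have hep : e.1 ∈ plaquetteEdges p := hP.fst_mem_plaquetteEdges (by simp)
  have heq : e.1 ∈ plaquetteEdges q := hQ.fst_mem_plaquetteEdges (by simp)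
  have hne : e.1 ≠ b.1 := by
    obtain ⟨⟨h12, h13, h14⟩, -, -⟩ := fst_ne_of_unit hP
    rcases hb with rfl | rfl | rfl <;> assumption
  exact hpq (eq_of_two_links hne hep hbp heq hbq)

/-- Cross distinctness: `bᵢ.1 ≠ cⱼ.1`. [cite: Chatterjee2019LargeN, §2.1] -/
theorem fst_ne_cross (hP : IsUnitLoop p [e, b₂, b₃, b₄]) (hQ : IsUnitLoop q [e, c₂, c₃, c₄]) (hpq : p ≠ q)
    {b c : DEdge d} (hb : b = b₂ ∨ b = b₃ ∨ b = b₄) (hc : c = c₂ ∨ c = c₃ ∨ c = c₄) : b.1 ≠ c.1 := by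
  intro h
  have hcQ : c ∈ [e, c₂, c₃, c₄] := by rcases hc with rfl | rfl | rfl <;> simp
  exact fst_not_mem_of_two_units hP hQ hpq hb (h ▸ hQ.fst_mem_plaquetteEdges hcQ)

/-- All pairwise edge-distinctness facts of the configuration, packaged. [cite: Chatterjee2019LargeN, §2.1, §2.2] -/
theorem distinct (hP : IsUnitLoop p [e, b₂, b₃, b₄]) (hQ : IsUnitLoop q [e, c₂, c₃, c₄]) (hpq : p ≠ q) :
    ((e.1 ≠ b₂.1 ∧ e.1 ≠ b₃.1 ∧ e.1 ≠ b₄.1) ∧ (b₂.1 ≠ b₃.1 ∧ b₂.1 ≠ b₄.1) ∧ b₃.1 ≠ b₄.1) ∧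
    ((e.1 ≠ c₂.1 ∧ e.1 ≠ c₃.1 ∧ e.1 ≠ c₄.1) ∧ (c₂.1 ≠ c₃.1 ∧ c₂.1 ≠ c₄.1) ∧ c₃.1 ≠ c₄.1) ∧
    ((b₂.1 ≠ c₂.1 ∧ b₂.1 ≠ c₃.1 ∧ b₂.1 ≠ c₄.1) ∧ (b₃.1 ≠ c₂.1 ∧ b₃.1 ≠ c₃.1 ∧ b₃.1 ≠ c₄.1) ∧
      (b₄.1 ≠ c₂.1 ∧ b₄.1 ≠ c₃.1 ∧ b₄.1 ≠ c₄.1)) := by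
  have X := fun (b c : DEdge d) (hb : b = b₂ ∨ b = b₃ ∨ b = b₄) (hc : c = c₂ ∨ c = c₃ ∨ c = c₄) =>
    fst_ne_cross hP hQ hpq hb hc
  exact ⟨fst_ne_of_unit hP, fst_ne_of_unit hQ,
    ⟨X b₂ c₂ (Or.inl rfl) (Or.inl rfl), X b₂ c₃ (Or.inl rfl) (Or.inr (Or.inl rfl)), X b₂ c₄ (Or.inl rfl) (Or.inr (Or.inr rfl))⟩,
    ⟨X b₃ c₂ (Or.inr (Or.inl rfl)) (Or.inl rfl), X b₃ c₃ (Or.inr (Or.inl rfl)) (Or.inr (Or.inl rfl)),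
      X b₃ c₄ (Or.inr (Or.inl rfl)) (Or.inr (Or.inr rfl))⟩,
    ⟨X b₄ c₂ (Or.inr (Or.inr rfl)) (Or.inl rfl), X b₄ c₃ (Or.inr (Or.inr rfl)) (Or.inr (Or.inl rfl)),
      X b₄ c₄ (Or.inr (Or.inr rfl)) (Or.inr (Or.inr rfl))⟩⟩

/-! #### The three secondary loops are loops: `w₆ = c₄⁻¹c₃⁻¹c₂⁻¹b₂b₃b₄ = ∂p ⊖ q`, `w₈ = e c₂c₃c₄ e b₂b₃b₄ = ∂p ⊕ q`, `V V = ∂p ⊕ p` -/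

/-- `c⁻¹ ⋯` : the inverse of `[c₂, c₃, c₄]`. [cite: Chatterjee2019LargeN, §2.1 (inverse path)] -/
theorem invRev_three (c₂ c₃ c₄ : DEdge d) :
    FreeGroup.invRev [c₂, c₃, c₄] = [DEdge.inv c₄, DEdge.inv c₃, DEdge.inv c₂] := by
  simp [FreeGroup.invRev, DEdge.inv]

/-- `(c₂ c₃)⁻¹ = c₃⁻¹ c₂⁻¹`. [cite: Chatterjee2019LargeN, §2.1 (inverse path)] -/
theorem invRev_two (c₂ c₃ : DEdge d) : FreeGroup.invRev [c₂, c₃] = [DEdge.inv c₃, DEdge.inv c₂] := by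
  simp [FreeGroup.invRev, DEdge.inv]

/-- `(c)⁻¹ = c⁻¹`. [cite: Chatterjee2019LargeN, §2.1 (inverse path)] -/
theorem invRev_one (c : DEdge d) : FreeGroup.invRev [c] = [DEdge.inv c] := by
  simp [FreeGroup.invRev, DEdge.inv]

/-- `(e c₂ c₃ c₄)⁻¹ = c₄⁻¹ c₃⁻¹ c₂⁻¹ e⁻¹`. [cite: Chatterjee2019LargeN, §2.1 (inverse path)] -/
theorem invRev_four (a₁ a₂ a₃ a₄ : DEdge d) :
    FreeGroup.invRev [a₁, a₂, a₃, a₄] = [DEdge.inv a₄, DEdge.inv a₃, DEdge.inv a₂, DEdge.inv a₁] := by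
  simp [FreeGroup.invRev, DEdge.inv]

/-- `w₆ = ∂(p ∪ q)` is a loop. [cite: Chatterjee2019LargeN, §2.2 («the positive and negative mergers produce new loops»)] -/
theorem isLoop_w6 (hP : IsUnitLoop p [e, b₂, b₃, b₄]) (hQ : IsUnitLoop q [e, c₂, c₃, c₄]) (hpq : p ≠ q) :
    IsLoop [DEdge.inv c₄, DEdge.inv c₃, DEdge.inv c₂, b₂, b₃, b₄] := by
  obtain ⟨⟨⟨heb2, heb3, heb4⟩, ⟨hb23, hb24⟩, hb34⟩, ⟨⟨hec2, hec3, hec4⟩, ⟨hc23, hc24⟩, hc34⟩,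
    ⟨⟨h22, h23, h24⟩, ⟨h32, h33, h34⟩, ⟨h42, h43, h44⟩⟩⟩ := distinct hP hQ hpq
  refine ⟨?_, isCyclicallyReduced_of_fst_ne ?_ ?_⟩
  · have hB := hP.isLoop.1.isPathFromTo_tail
    have hC := (hQ.isLoop.1.isPathFromTo_tail).invRev
    rw [invRev_three] at hC
    have h := hC.append hB
    exact h.isClosedPath
  · simp only [List.isChain_cons_cons, List.isChain_singleton, DEdge.inv, and_true]
    exact ⟨hc34.symm, hc23.symm, fun h => h22 h.symm, hb23, hb34⟩
  · simp [DEdge.inv, h44]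

/-- `w₈ = ∂p ⊕ q` (the figure eight through `e` twice) is a loop. [cite: Chatterjee2019LargeN, §2.2] -/
theorem isLoop_w8 (hP : IsUnitLoop p [e, b₂, b₃, b₄]) (hQ : IsUnitLoop q [e, c₂, c₃, c₄]) (hpq : p ≠ q) :
    IsLoop [e, c₂, c₃, c₄, e, b₂, b₃, b₄] := by
  obtain ⟨⟨⟨heb2, heb3, heb4⟩, ⟨hb23, hb24⟩, hb34⟩, ⟨⟨hec2, hec3, hec4⟩, ⟨hc23, hc24⟩, hc34⟩, -⟩ := distinct hP hQ hpq
  refine ⟨?_, isCyclicallyReduced_of_fst_ne ?_ ?_⟩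
  · exact ((hQ.isLoop.1.isPathFromTo_cons).append hP.isLoop.1.isPathFromTo_cons).isClosedPath
  · simp only [List.isChain_cons_cons, List.isChain_singleton, and_true]
    exact ⟨hec2, hc23, hc34, fun h => hec4 h.symm, heb2, hb23, hb34⟩
  · simpa using fun h => heb4 (Eq.symm h)

/-- `V V = ∂p ⊕ p` (the plaquette run twice) is a loop, for any unit loop `V`. [cite: Chatterjee2019LargeN, §2.2] -/
theorem isLoop_double {f g₂ g₃ g₄ : DEdge d} (hV : IsUnitLoop p [f, g₂, g₃, g₄]) :
    IsLoop [f, g₂, g₃, g₄, f, g₂, g₃, g₄] := by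
  obtain ⟨⟨h12, h13, h14⟩, ⟨h23, h24⟩, h34⟩ := fst_ne_of_unit hV
  refine ⟨?_, isCyclicallyReduced_of_fst_ne ?_ ?_⟩
  · exact ((hV.isLoop.1.isPathFromTo_cons).append hV.isLoop.1.isPathFromTo_cons).isClosedPath
  · simp only [List.isChain_cons_cons, List.isChain_singleton, and_true]
    exact ⟨h12, h23, h34, fun h => h14 h.symm, h12, h23, h34⟩
  · simpa using fun h => h14 (Eq.symm h)

/-! #### `∂p ⊖ₓ q = w₆`, `∂p ⊕ₓ q = w₈`, `∂p ⊕ₓ p = PP` -/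

/-- `P ⊖₀ q = w₆`. [cite: Chatterjee2019LargeN, §2.2 (negative deformation)] -/
theorem negDeform_P_q (hP : IsUnitLoop p [e, b₂, b₃, b₄]) (hQ : IsUnitLoop q [e, c₂, c₃, c₄]) (hpq : p ≠ q) :
    Word.negDeform [e, b₂, b₃, b₄] ⟨0, by simp⟩ q = [DEdge.inv c₄, DEdge.inv c₃, DEdge.inv c₂, b₂, b₃, b₄] := by
  rw [hQ.negDeform_eq ⟨0, by simp⟩ ⟨0, by simp⟩ (t := [b₂, b₃, b₄]) rfl]
  show core (FreeGroup.invRev [c₂, c₃, c₄] ++ [b₂, b₃, b₄]) = _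
  rw [invRev_three]
  exact (isLoop_w6 hP hQ hpq).core_eq

/-- `P ⊕₀ q = w₈`. [cite: Chatterjee2019LargeN, §2.2 (positive deformation)] -/
theorem posDeform_P_q (hP : IsUnitLoop p [e, b₂, b₃, b₄]) (hQ : IsUnitLoop q [e, c₂, c₃, c₄]) (hpq : p ≠ q) :
    Word.posDeform [e, b₂, b₃, b₄] ⟨0, by simp⟩ q = [e, c₂, c₃, c₄, e, b₂, b₃, b₄] := by
  rw [hQ.posDeform_eq ⟨0, by simp⟩ ⟨0, by simp⟩ (t := [b₂, b₃, b₄]) rfl]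
  exact (isLoop_w8 hP hQ hpq).core_eq

/-- `V ⊕₀ p = V V`. [cite: Chatterjee2019LargeN, §2.2 (positive deformation)] -/
theorem posDeform_V_p {f g₂ g₃ g₄ : DEdge d} (hV : IsUnitLoop p [f, g₂, g₃, g₄]) :
    Word.posDeform [f, g₂, g₃, g₄] ⟨0, by simp⟩ p = [f, g₂, g₃, g₄, f, g₂, g₃, g₄] := by
  rw [hV.posDeform_eq ⟨0, by simp⟩ ⟨0, by simp⟩ (t := [g₂, g₃, g₄]) rfl]
  exact (isLoop_double hV).core_eq

/-! #### Deformations only see the loop read from the location -/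

/-- A deformation of `w` at `y` only depends on `w` read from `y`. [cite: Chatterjee2019LargeN, §2.2 (l ⊖ₓ p is defined on the cycle)] -/
theorem negDeform_eq_of_rotate_eq {w w' : Word d} {y : Fin w.length} {y' : Fin w'.length}
    (h : w.rotate y = w'.rotate y') (q' : ZdPlaquette d) : Word.negDeform w y q' = Word.negDeform w' y' q' := by
  have h1 := Word.rotate_eq_letter_cons_drop w y
  have h2 := Word.rotate_eq_letter_cons_drop w' y'
  have hl : w.letter y = w'.letter y' := (List.cons.inj (h1.symm.trans (h.trans h2))).1
  rw [Word.negDeform, Word.negDeform, h, hl]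

/-- Likewise for positive deformations. [cite: Chatterjee2019LargeN, §2.2 (l ⊕ₓ p is defined on the cycle)] -/
theorem posDeform_eq_of_rotate_eq {w w' : Word d} {y : Fin w.length} {y' : Fin w'.length}
    (h : w.rotate y = w'.rotate y') (q' : ZdPlaquette d) : Word.posDeform w y q' = Word.posDeform w' y' q' := by
  have h1 := Word.rotate_eq_letter_cons_drop w y
  have h2 := Word.rotate_eq_letter_cons_drop w' y'
  have hl : w.letter y = w'.letter y' := (List.cons.inj (h1.symm.trans (h.trans h2))).1
  rw [Word.posDeform, Word.posDeform, h, hl]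

/-! #### `w₆ ⊖ q` at the three `q`-letters is `P`; `w₆ ⊖ p` at the three `p`-letters is `(e c₂ c₃ c₄)⁻¹` -/

/-- `Q⁻¹ = c₄⁻¹ c₃⁻¹ c₂⁻¹ e⁻¹` is a unit loop of `q`. [cite: Chatterjee2019LargeN, §2.1] -/
theorem unit_invQ (hQ : IsUnitLoop q [e, c₂, c₃, c₄]) :
    IsUnitLoop q [DEdge.inv c₄, DEdge.inv c₃, DEdge.inv c₂, DEdge.inv e] := by
  have := hQ.invRev; rwa [invRev_four] at this

/-- `(c₂ c₃ c₄ e)⁻¹ = e⁻¹ c₄⁻¹ c₃⁻¹ c₂⁻¹` is a unit loop of `q`. [cite: Chatterjee2019LargeN, §2.1] -/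
theorem unit_M (hQ : IsUnitLoop q [e, c₂, c₃, c₄]) :
    IsUnitLoop q [DEdge.inv e, DEdge.inv c₄, DEdge.inv c₃, DEdge.inv c₂] := by
  have := (hQ.rotate 1).invRev
  rwa [show [e, c₂, c₃, c₄].rotate 1 = [c₂, c₃, c₄, e] from rfl, invRev_four] at this

/-- `b₂ b₃ b₄ e` is a unit loop of `p`. [cite: Chatterjee2019LargeN, §2.1] -/
theorem unit_rot1 {f g₂ g₃ g₄ : DEdge d} (hV : IsUnitLoop p [f, g₂, g₃, g₄]) : IsUnitLoop p [g₂, g₃, g₄, f] := by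
  have := hV.rotate 1; rwa [show [f, g₂, g₃, g₄].rotate 1 = [g₂, g₃, g₄, f] from rfl] at this

/-- `w₆ ⊖₀ q = P` (at the letter `c₄⁻¹`). [cite: Chatterjee2019LargeN, §2.2 (negative deformation, case l' = c e⁻¹ d)] -/
theorem negDeform_w6_0 (hP : IsUnitLoop p [e, b₂, b₃, b₄]) (hQ : IsUnitLoop q [e, c₂, c₃, c₄]) :
    Word.negDeform [DEdge.inv c₄, DEdge.inv c₃, DEdge.inv c₂, b₂, b₃, b₄] ⟨0, by simp⟩ q = [e, b₂, b₃, b₄] := by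
  rw [(unit_invQ hQ).negDeform_eq ⟨0, by simp⟩ ⟨0, by simp⟩ (t := [DEdge.inv c₃, DEdge.inv c₂, b₂, b₃, b₄]) rfl]
  show core (FreeGroup.invRev [DEdge.inv c₃, DEdge.inv c₂, DEdge.inv e] ++ _) = _
  have hred := red_cancel_middle' [e] [c₂, c₃] [b₂, b₃, b₄]
  rw [invRev_two] at hred
  rw [invRev_three]
  simp only [DEdge.inv_inv, List.cons_append, List.nil_append] at hred ⊢
  rw [core_eq_of_red hred]
  exact hP.isLoop.core_eq

/-- `w₆ ⊖₁ q = P` (at the letter `c₃⁻¹`). [cite: Chatterjee2019LargeN, §2.2 (negative deformation, case l' = c e⁻¹ d)] -/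
theorem negDeform_w6_1 (hP : IsUnitLoop p [e, b₂, b₃, b₄]) (hQ : IsUnitLoop q [e, c₂, c₃, c₄]) (hpq : p ≠ q) :
    Word.negDeform [DEdge.inv c₄, DEdge.inv c₃, DEdge.inv c₂, b₂, b₃, b₄] ⟨1, by simp⟩ q = [e, b₂, b₃, b₄] := by
  obtain ⟨⟨⟨heb2, heb3, heb4⟩, ⟨hb23, hb24⟩, hb34⟩, ⟨⟨hec2, hec3, hec4⟩, ⟨hc23, hc24⟩, hc34⟩,
    ⟨⟨h22, h23, h24⟩, ⟨h32, h33, h34⟩, ⟨h42, h43, h44⟩⟩⟩ := distinct hP hQ hpq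
  rw [(unit_invQ hQ).negDeform_eq ⟨1, by simp⟩ ⟨1, by simp⟩ (t := [DEdge.inv c₂, b₂, b₃, b₄, DEdge.inv c₄]) rfl]
  show core (FreeGroup.invRev [DEdge.inv c₂, DEdge.inv e, DEdge.inv c₄] ++ _) = _
  have hred := red_cancel_middle' [c₄, e] [c₂] [b₂, b₃, b₄, DEdge.inv c₄]
  rw [invRev_one] at hred
  rw [invRev_three]
  simp only [DEdge.inv_inv, List.cons_append, List.nil_append] at hred ⊢
  rw [core_eq_of_red hred]
  have hshape : [c₄, e, b₂, b₃, b₄, DEdge.inv c₄] = FreeGroup.invRev [DEdge.inv c₄] ++ [e, b₂, b₃, b₄] ++ [DEdge.inv c₄] := by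
    simp [FreeGroup.invRev, DEdge.inv]
  rw [hshape]
  refine core_conj hP.isLoop _ ?_
  rw [← hshape]
  refine isReduced_of_fst_ne ?_
  simp only [List.isChain_cons_cons, List.isChain_singleton, DEdge.inv, and_true]
  exact ⟨fun h => hec4 h.symm, heb2, hb23, hb34, h44⟩

/-- `w₆ ⊖₂ q = P` (at the letter `c₂⁻¹`). [cite: Chatterjee2019LargeN, §2.2 (negative deformation, case l' = c e⁻¹ d)] -/
theorem negDeform_w6_2 (hP : IsUnitLoop p [e, b₂, b₃, b₄]) (hQ : IsUnitLoop q [e, c₂, c₃, c₄]) (hpq : p ≠ q) :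
    Word.negDeform [DEdge.inv c₄, DEdge.inv c₃, DEdge.inv c₂, b₂, b₃, b₄] ⟨2, by simp⟩ q = [e, b₂, b₃, b₄] := by
  obtain ⟨⟨⟨heb2, heb3, heb4⟩, ⟨hb23, hb24⟩, hb34⟩, ⟨⟨hec2, hec3, hec4⟩, ⟨hc23, hc24⟩, hc34⟩,
    ⟨⟨h22, h23, h24⟩, ⟨h32, h33, h34⟩, ⟨h42, h43, h44⟩⟩⟩ := distinct hP hQ hpq
  rw [(unit_invQ hQ).negDeform_eq ⟨2, by simp⟩ ⟨2, by simp⟩ (t := [b₂, b₃, b₄, DEdge.inv c₄, DEdge.inv c₃]) rfl]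
  show core (FreeGroup.invRev [DEdge.inv e, DEdge.inv c₄, DEdge.inv c₃] ++ _) = _
  rw [invRev_three]
  simp only [DEdge.inv_inv, List.cons_append, List.nil_append]
  have hshape : [c₃, c₄, e, b₂, b₃, b₄, DEdge.inv c₄, DEdge.inv c₃]
      = FreeGroup.invRev [DEdge.inv c₄, DEdge.inv c₃] ++ [e, b₂, b₃, b₄] ++ [DEdge.inv c₄, DEdge.inv c₃] := by
    simp [FreeGroup.invRev, DEdge.inv]
  rw [hshape]
  refine core_conj hP.isLoop _ ?_
  rw [← hshape]
  refine isReduced_of_fst_ne ?_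
  simp only [List.isChain_cons_cons, List.isChain_singleton, DEdge.inv, and_true]
  exact ⟨hc34, fun h => hec4 h.symm, heb2, hb23, hb34, h44, hc34.symm⟩

/-- `w₆ ⊖₃ p = e⁻¹ c₄⁻¹ c₃⁻¹ c₂⁻¹` (at the letter `b₂`). [cite: Chatterjee2019LargeN, §2.2 (negative deformation, case l' = c e d)] -/
theorem negDeform_w6_3 (hP : IsUnitLoop p [e, b₂, b₃, b₄]) (hQ : IsUnitLoop q [e, c₂, c₃, c₄]) :
    Word.negDeform [DEdge.inv c₄, DEdge.inv c₃, DEdge.inv c₂, b₂, b₃, b₄] ⟨3, by simp⟩ p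
      = [DEdge.inv e, DEdge.inv c₄, DEdge.inv c₃, DEdge.inv c₂] := by
  rw [hP.negDeform_eq ⟨1, by simp⟩ ⟨3, by simp⟩ (t := [b₃, b₄, DEdge.inv c₄, DEdge.inv c₃, DEdge.inv c₂]) rfl]
  show core (FreeGroup.invRev [b₃, b₄, e] ++ _) = _
  have hred := red_cancel_middle [DEdge.inv e] [b₃, b₄] [DEdge.inv c₄, DEdge.inv c₃, DEdge.inv c₂]
  rw [invRev_two] at hred
  rw [invRev_three]
  simp only [List.cons_append, List.nil_append] at hred ⊢
  rw [core_eq_of_red hred]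
  exact (unit_M hQ).isLoop.core_eq

/-- `w₆ ⊖₄ p = e⁻¹ c₄⁻¹ c₃⁻¹ c₂⁻¹` (at the letter `b₃`). [cite: Chatterjee2019LargeN, §2.2 (negative deformation, case l' = c e d)] -/
theorem negDeform_w6_4 (hP : IsUnitLoop p [e, b₂, b₃, b₄]) (hQ : IsUnitLoop q [e, c₂, c₃, c₄]) (hpq : p ≠ q) :
    Word.negDeform [DEdge.inv c₄, DEdge.inv c₃, DEdge.inv c₂, b₂, b₃, b₄] ⟨4, by simp⟩ p
      = [DEdge.inv e, DEdge.inv c₄, DEdge.inv c₃, DEdge.inv c₂] := by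
  obtain ⟨⟨⟨heb2, heb3, heb4⟩, ⟨hb23, hb24⟩, hb34⟩, ⟨⟨hec2, hec3, hec4⟩, ⟨hc23, hc24⟩, hc34⟩,
    ⟨⟨h22, h23, h24⟩, ⟨h32, h33, h34⟩, ⟨h42, h43, h44⟩⟩⟩ := distinct hP hQ hpq
  rw [hP.negDeform_eq ⟨2, by simp⟩ ⟨4, by simp⟩ (t := [b₄, DEdge.inv c₄, DEdge.inv c₃, DEdge.inv c₂, b₂]) rfl]
  show core (FreeGroup.invRev [b₄, e, b₂] ++ _) = _
  have hred := red_cancel_middle [DEdge.inv b₂, DEdge.inv e] [b₄] [DEdge.inv c₄, DEdge.inv c₃, DEdge.inv c₂, b₂]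
  rw [invRev_one] at hred
  rw [invRev_three]
  simp only [List.cons_append, List.nil_append] at hred ⊢
  rw [core_eq_of_red hred]
  have hshape : [DEdge.inv b₂, DEdge.inv e, DEdge.inv c₄, DEdge.inv c₃, DEdge.inv c₂, b₂]
      = FreeGroup.invRev [b₂] ++ [DEdge.inv e, DEdge.inv c₄, DEdge.inv c₃, DEdge.inv c₂] ++ [b₂] := by
    simp [FreeGroup.invRev, DEdge.inv]
  rw [hshape]
  refine core_conj (unit_M hQ).isLoop _ ?_
  rw [← hshape]
  refine isReduced_of_fst_ne ?_
  simp only [List.isChain_cons_cons, List.isChain_singleton, DEdge.inv, and_true]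
  exact ⟨fun h => heb2 h.symm, hec4, hc34.symm, hc23.symm, fun h => h22 h.symm⟩

/-- `w₆ ⊖₅ p = e⁻¹ c₄⁻¹ c₃⁻¹ c₂⁻¹` (at the letter `b₄`). [cite: Chatterjee2019LargeN, §2.2 (negative deformation, case l' = c e d)] -/
theorem negDeform_w6_5 (hP : IsUnitLoop p [e, b₂, b₃, b₄]) (hQ : IsUnitLoop q [e, c₂, c₃, c₄]) (hpq : p ≠ q) :
    Word.negDeform [DEdge.inv c₄, DEdge.inv c₃, DEdge.inv c₂, b₂, b₃, b₄] ⟨5, by simp⟩ p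
      = [DEdge.inv e, DEdge.inv c₄, DEdge.inv c₃, DEdge.inv c₂] := by
  obtain ⟨⟨⟨heb2, heb3, heb4⟩, ⟨hb23, hb24⟩, hb34⟩, ⟨⟨hec2, hec3, hec4⟩, ⟨hc23, hc24⟩, hc34⟩,
    ⟨⟨h22, h23, h24⟩, ⟨h32, h33, h34⟩, ⟨h42, h43, h44⟩⟩⟩ := distinct hP hQ hpq
  rw [hP.negDeform_eq ⟨3, by simp⟩ ⟨5, by simp⟩ (t := [DEdge.inv c₄, DEdge.inv c₃, DEdge.inv c₂, b₂, b₃]) rfl]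
  show core (FreeGroup.invRev [e, b₂, b₃] ++ _) = _
  rw [invRev_three]
  simp only [List.cons_append, List.nil_append]
  have hshape : [DEdge.inv b₃, DEdge.inv b₂, DEdge.inv e, DEdge.inv c₄, DEdge.inv c₃, DEdge.inv c₂, b₂, b₃]
      = FreeGroup.invRev [b₂, b₃] ++ [DEdge.inv e, DEdge.inv c₄, DEdge.inv c₃, DEdge.inv c₂] ++ [b₂, b₃] := by
    simp [FreeGroup.invRev, DEdge.inv]
  rw [hshape]
  refine core_conj (unit_M hQ).isLoop _ ?_
  rw [← hshape]
  refine isReduced_of_fst_ne ?_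
  simp only [List.isChain_cons_cons, List.isChain_singleton, DEdge.inv, and_true]
  exact ⟨hb23.symm, fun h => heb2 h.symm, hec4, hc34.symm, hc23.symm, fun h => h22 h.symm, hb23⟩

/-! #### `w₈ ⊖` at its letters: by `q` at `e, c₂, c₃, c₄` and by `p` at `e` (the other half by the symmetry `p ↔ q`) -/

/-- `w₈ ⊖₀ q = P` (at the first `e`). [cite: Chatterjee2019LargeN, §2.2 (negative deformation, case l' = c e d)] -/
theorem negDeform_w8_0q (hP : IsUnitLoop p [e, b₂, b₃, b₄]) (hQ : IsUnitLoop q [e, c₂, c₃, c₄]) :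
    Word.negDeform [e, c₂, c₃, c₄, e, b₂, b₃, b₄] ⟨0, by simp⟩ q = [e, b₂, b₃, b₄] := by
  rw [hQ.negDeform_eq ⟨0, by simp⟩ ⟨0, by simp⟩ (t := [c₂, c₃, c₄, e, b₂, b₃, b₄]) rfl]
  show core (FreeGroup.invRev [c₂, c₃, c₄] ++ _) = _
  have hred := red_cancel_middle [] [c₂, c₃, c₄] [e, b₂, b₃, b₄]
  rw [invRev_three] at hred ⊢
  simp only [List.cons_append, List.nil_append] at hred ⊢
  rw [core_eq_of_red hred]
  exact hP.isLoop.core_eq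

/-- `w₈ ⊖₀ p = c₂ c₃ c₄ e` (at the first `e`). [cite: Chatterjee2019LargeN, §2.2 (negative deformation, case l' = c e d)] -/
theorem negDeform_w8_0p (hP : IsUnitLoop p [e, b₂, b₃, b₄]) (hQ : IsUnitLoop q [e, c₂, c₃, c₄]) (hpq : p ≠ q) :
    Word.negDeform [e, c₂, c₃, c₄, e, b₂, b₃, b₄] ⟨0, by simp⟩ p = [c₂, c₃, c₄, e] := by
  obtain ⟨⟨⟨heb2, heb3, heb4⟩, ⟨hb23, hb24⟩, hb34⟩, ⟨⟨hec2, hec3, hec4⟩, ⟨hc23, hc24⟩, hc34⟩,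
    ⟨⟨h22, h23, h24⟩, ⟨h32, h33, h34⟩, ⟨h42, h43, h44⟩⟩⟩ := distinct hP hQ hpq
  rw [hP.negDeform_eq ⟨0, by simp⟩ ⟨0, by simp⟩ (t := [c₂, c₃, c₄, e, b₂, b₃, b₄]) rfl]
  show core (FreeGroup.invRev [b₂, b₃, b₄] ++ _) = _
  have hshape : FreeGroup.invRev [b₂, b₃, b₄] ++ [c₂, c₃, c₄, e, b₂, b₃, b₄]
      = FreeGroup.invRev [b₂, b₃, b₄] ++ [c₂, c₃, c₄, e] ++ [b₂, b₃, b₄] := by simp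
  rw [hshape]
  refine core_conj (unit_rot1 hQ).isLoop _ ?_
  rw [invRev_three]
  refine isReduced_of_fst_ne ?_
  simp only [List.cons_append, List.nil_append, List.isChain_cons_cons, List.isChain_singleton, DEdge.inv, and_true]
  exact ⟨hb34.symm, hb23.symm, h22, hc23, hc34, fun h => hec4 h.symm, heb2, hb23, hb34⟩

/-- `w₈ ⊖₁ q = b₂ b₃ b₄ e` (at the letter `c₂`). [cite: Chatterjee2019LargeN, §2.2 (negative deformation, case l' = c e d)] -/
theorem negDeform_w8_1q (hP : IsUnitLoop p [e, b₂, b₃, b₄]) (hQ : IsUnitLoop q [e, c₂, c₃, c₄]) :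
    Word.negDeform [e, c₂, c₃, c₄, e, b₂, b₃, b₄] ⟨1, by simp⟩ q = [b₂, b₃, b₄, e] := by
  rw [hQ.negDeform_eq ⟨1, by simp⟩ ⟨1, by simp⟩ (t := [c₃, c₄, e, b₂, b₃, b₄, e]) rfl]
  show core (FreeGroup.invRev [c₃, c₄, e] ++ _) = _
  have hred₁ := red_cancel_middle [DEdge.inv e] [c₃, c₄] [e, b₂, b₃, b₄, e]
  have hred₂ := red_cancel_middle [] [e] [b₂, b₃, b₄, e]
  rw [invRev_two] at hred₁
  rw [invRev_one] at hred₂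
  rw [invRev_three]
  simp only [List.cons_append, List.nil_append] at hred₁ hred₂ ⊢
  rw [core_eq_of_red (hred₁.trans hred₂)]
  exact (unit_rot1 hP).isLoop.core_eq

/-- `w₈ ⊖₂ q = b₂ b₃ b₄ e` (at the letter `c₃`). [cite: Chatterjee2019LargeN, §2.2 (negative deformation, case l' = c e d)] -/
theorem negDeform_w8_2q (hP : IsUnitLoop p [e, b₂, b₃, b₄]) (hQ : IsUnitLoop q [e, c₂, c₃, c₄]) (hpq : p ≠ q) :
    Word.negDeform [e, c₂, c₃, c₄, e, b₂, b₃, b₄] ⟨2, by simp⟩ q = [b₂, b₃, b₄, e] := by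
  obtain ⟨⟨⟨heb2, heb3, heb4⟩, ⟨hb23, hb24⟩, hb34⟩, ⟨⟨hec2, hec3, hec4⟩, ⟨hc23, hc24⟩, hc34⟩,
    ⟨⟨h22, h23, h24⟩, ⟨h32, h33, h34⟩, ⟨h42, h43, h44⟩⟩⟩ := distinct hP hQ hpq
  rw [hQ.negDeform_eq ⟨2, by simp⟩ ⟨2, by simp⟩ (t := [c₄, e, b₂, b₃, b₄, e, c₂]) rfl]
  show core (FreeGroup.invRev [c₄, e, c₂] ++ _) = _
  have hred₁ := red_cancel_middle [DEdge.inv c₂, DEdge.inv e] [c₄] [e, b₂, b₃, b₄, e, c₂]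
  have hred₂ := red_cancel_middle [DEdge.inv c₂] [e] [b₂, b₃, b₄, e, c₂]
  rw [invRev_one] at hred₁ hred₂
  rw [invRev_three]
  simp only [List.cons_append, List.nil_append] at hred₁ hred₂ ⊢
  rw [core_eq_of_red (hred₁.trans hred₂)]
  have hshape : [DEdge.inv c₂, b₂, b₃, b₄, e, c₂] = FreeGroup.invRev [c₂] ++ [b₂, b₃, b₄, e] ++ [c₂] := by
    simp [FreeGroup.invRev, DEdge.inv]
  rw [hshape]
  refine core_conj (unit_rot1 hP).isLoop _ ?_
  rw [← hshape]
  refine isReduced_of_fst_ne ?_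
  simp only [List.isChain_cons_cons, List.isChain_singleton, DEdge.inv, and_true]
  exact ⟨fun h => h22 h.symm, hb23, hb34, fun h => heb4 h.symm, hec2⟩

/-- `w₈ ⊖₃ q = b₂ b₃ b₄ e` (at the letter `c₄`). [cite: Chatterjee2019LargeN, §2.2 (negative deformation, case l' = c e d)] -/
theorem negDeform_w8_3q (hP : IsUnitLoop p [e, b₂, b₃, b₄]) (hQ : IsUnitLoop q [e, c₂, c₃, c₄]) (hpq : p ≠ q) :
    Word.negDeform [e, c₂, c₃, c₄, e, b₂, b₃, b₄] ⟨3, by simp⟩ q = [b₂, b₃, b₄, e] := by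
  obtain ⟨⟨⟨heb2, heb3, heb4⟩, ⟨hb23, hb24⟩, hb34⟩, ⟨⟨hec2, hec3, hec4⟩, ⟨hc23, hc24⟩, hc34⟩,
    ⟨⟨h22, h23, h24⟩, ⟨h32, h33, h34⟩, ⟨h42, h43, h44⟩⟩⟩ := distinct hP hQ hpq
  rw [hQ.negDeform_eq ⟨3, by simp⟩ ⟨3, by simp⟩ (t := [e, b₂, b₃, b₄, e, c₂, c₃]) rfl]
  show core (FreeGroup.invRev [e, c₂, c₃] ++ _) = _
  have hred := red_cancel_middle [DEdge.inv c₃, DEdge.inv c₂] [e] [b₂, b₃, b₄, e, c₂, c₃]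
  rw [invRev_one] at hred
  rw [invRev_three]
  simp only [List.cons_append, List.nil_append] at hred ⊢
  rw [core_eq_of_red hred]
  have hshape : [DEdge.inv c₃, DEdge.inv c₂, b₂, b₃, b₄, e, c₂, c₃]
      = FreeGroup.invRev [c₂, c₃] ++ [b₂, b₃, b₄, e] ++ [c₂, c₃] := by
    simp [FreeGroup.invRev, DEdge.inv]
  rw [hshape]
  refine core_conj (unit_rot1 hP).isLoop _ ?_
  rw [← hshape]
  refine isReduced_of_fst_ne ?_
  simp only [List.isChain_cons_cons, List.isChain_singleton, DEdge.inv, and_true]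
  exact ⟨hc23.symm, fun h => h22 h.symm, hb23, hb34, fun h => heb4 h.symm, hec2, hc23⟩

/-! #### `VV ⊖₀ p = V` for a unit loop `V` of `p` -/

/-- `V V ⊖₀ p = V`. [cite: Chatterjee2019LargeN, §2.2 (negative deformation, case l' = c e d)] -/
theorem negDeform_double_0 {f g₂ g₃ g₄ : DEdge d} (hV : IsUnitLoop p [f, g₂, g₃, g₄]) :
    Word.negDeform [f, g₂, g₃, g₄, f, g₂, g₃, g₄] ⟨0, by simp⟩ p = [f, g₂, g₃, g₄] := by
  rw [hV.negDeform_eq ⟨0, by simp⟩ ⟨0, by simp⟩ (t := [g₂, g₃, g₄, f, g₂, g₃, g₄]) rfl]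
  show core (FreeGroup.invRev [g₂, g₃, g₄] ++ _) = _
  have hred := red_cancel_middle [] [g₂, g₃, g₄] [f, g₂, g₃, g₄]
  rw [invRev_three] at hred ⊢
  simp only [List.cons_append, List.nil_append] at hred ⊢
  rw [core_eq_of_red hred]
  exact hV.isLoop.core_eq

/-! #### Positive splittings of `w₈` and of `VV` -/

/-- The cyclic gaps `(4 − 0)` and `(0 − 4)` in a word of length `8` are both `4`. [cite: Chatterjee2019LargeN, §2.1 (locations in a cycle)] -/
theorem gap_04 (l : Word d) (h : l.length = 8) :
    Word.gap l ⟨0, by omega⟩ ⟨4, by omega⟩ = 4 ∧ Word.gap l ⟨4, by omega⟩ ⟨0, by omega⟩ = 4 := by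
  constructor <;> (rw [Word.gap, Fin.sub_def]; simp [h])

/-- `×¹_{0,4} w₈ = P`, `×²_{0,4} w₈ = c₂ c₃ c₄ e`. [cite: Chatterjee2019LargeN, §2.2 (positive splitting ×¹, ×²)] -/
theorem posSplit_w8_04 (hP : IsUnitLoop p [e, b₂, b₃, b₄]) (hQ : IsUnitLoop q [e, c₂, c₃, c₄]) :
    Word.posSplit₁ [e, c₂, c₃, c₄, e, b₂, b₃, b₄] ⟨0, by simp⟩ ⟨4, by simp⟩ = [e, b₂, b₃, b₄] ∧
    Word.posSplit₂ [e, c₂, c₃, c₄, e, b₂, b₃, b₄] ⟨0, by simp⟩ ⟨4, by simp⟩ = [c₂, c₃, c₄, e] := by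
  have hg := (gap_04 [e, c₂, c₃, c₄, e, b₂, b₃, b₄] rfl).1
  constructor
  · rw [Word.posSplit₁, Word.arcAfter, hg]
    exact hP.isLoop.core_eq
  · rw [Word.posSplit₂, Word.arcBetween, hg]
    exact (unit_rot1 hQ).isLoop.core_eq

/-- `×¹_{4,0} w₈ = Q`, `×²_{4,0} w₈ = b₂ b₃ b₄ e`. [cite: Chatterjee2019LargeN, §2.2 (positive splitting ×¹, ×²)] -/
theorem posSplit_w8_40 (hP : IsUnitLoop p [e, b₂, b₃, b₄]) (hQ : IsUnitLoop q [e, c₂, c₃, c₄]) :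
    Word.posSplit₁ [e, c₂, c₃, c₄, e, b₂, b₃, b₄] ⟨4, by simp⟩ ⟨0, by simp⟩ = [e, c₂, c₃, c₄] ∧
    Word.posSplit₂ [e, c₂, c₃, c₄, e, b₂, b₃, b₄] ⟨4, by simp⟩ ⟨0, by simp⟩ = [b₂, b₃, b₄, e] := by
  have hg := (gap_04 [e, c₂, c₃, c₄, e, b₂, b₃, b₄] rfl).2
  constructor
  · rw [Word.posSplit₁, Word.arcAfter, hg]
    exact hQ.isLoop.core_eq
  · rw [Word.posSplit₂, Word.arcBetween, hg]
    exact (unit_rot1 hP).isLoop.core_eq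

/-- `×¹_{0,4} (V V) = V`, `×²_{0,4} (V V) = g₂ g₃ g₄ f`. [cite: Chatterjee2019LargeN, §2.2 (positive splitting ×¹, ×²)] -/
theorem posSplit_double_04 {f g₂ g₃ g₄ : DEdge d} (hV : IsUnitLoop p [f, g₂, g₃, g₄]) :
    Word.posSplit₁ [f, g₂, g₃, g₄, f, g₂, g₃, g₄] ⟨0, by simp⟩ ⟨4, by simp⟩ = [f, g₂, g₃, g₄] ∧
    Word.posSplit₂ [f, g₂, g₃, g₄, f, g₂, g₃, g₄] ⟨0, by simp⟩ ⟨4, by simp⟩ = [g₂, g₃, g₄, f] := by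
  have hg := (gap_04 [f, g₂, g₃, g₄, f, g₂, g₃, g₄] rfl).1
  constructor
  · rw [Word.posSplit₁, Word.arcAfter, hg]
    exact hV.isLoop.core_eq
  · rw [Word.posSplit₂, Word.arcBetween, hg]
    exact (unit_rot1 hV).isLoop.core_eq

/-- `×¹_{4,0} (V V) = V`, `×²_{4,0} (V V) = g₂ g₃ g₄ f`. [cite: Chatterjee2019LargeN, §2.2 (positive splitting ×¹, ×²)] -/
theorem posSplit_double_40 {f g₂ g₃ g₄ : DEdge d} (hV : IsUnitLoop p [f, g₂, g₃, g₄]) :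
    Word.posSplit₁ [f, g₂, g₃, g₄, f, g₂, g₃, g₄] ⟨4, by simp⟩ ⟨0, by simp⟩ = [f, g₂, g₃, g₄] ∧
    Word.posSplit₂ [f, g₂, g₃, g₄, f, g₂, g₃, g₄] ⟨4, by simp⟩ ⟨0, by simp⟩ = [g₂, g₃, g₄, f] := by
  have hg := (gap_04 [f, g₂, g₃, g₄, f, g₂, g₃, g₄] rfl).2
  constructor
  · rw [Word.posSplit₁, Word.arcAfter, hg]
    exact hV.isLoop.core_eq
  · rw [Word.posSplit₂, Word.arcBetween, hg]
    exact (unit_rot1 hV).isLoop.core_eq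

/-! ### Index bookkeeping for one-loop sequences `(w)` -/

/-- Unpacking a deformation index of `(w)`: a location `y` of `w` and a plaquette through its edge.
[cite: Chatterjee2019LargeN, §2.2 (𝔻±(s))] -/
theorem deformIdx_elim {w : Word d} (o : DeformIdx [w]) :
    ∃ (y : Fin w.length) (q' : ZdPlaquette d) (hq' : q' ∈ plaquettesAt (w.get y)),
      o = ⟨⟨0, Nat.zero_lt_one⟩, y, ⟨q', hq'⟩⟩ := by
  obtain ⟨⟨i, hi⟩, y, q', hq'⟩ := o
  have hi0 : i = 0 := by simp only [List.length_singleton] at hi; omega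
  subst hi0
  exact ⟨y, q', hq', rfl⟩

/-- Unpacking a same-edge index of `(w)`. [cite: Chatterjee2019LargeN, §2.2 (𝕊⁺(s))] -/
theorem sameIdx_elim {w : Word d} (o : SameIdx [w]) :
    ∃ (x y : Fin w.length) (hxy : x ≠ y ∧ w.get y = w.get x), o = ⟨⟨0, Nat.zero_lt_one⟩, ⟨(x, y), hxy⟩⟩ := by
  obtain ⟨⟨i, hi⟩, ⟨⟨x, y⟩, hxy⟩⟩ := o
  have hi0 : i = 0 := by simp only [List.length_singleton] at hi; omega
  subst hi0
  exact ⟨x, y, hxy, rfl⟩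

/-- `𝕊⁻((w))` is empty when no letter of `w` occurs inverted in `w`. [cite: Chatterjee2019LargeN, §2.2 (𝕊⁻(s))] -/
theorem invIdx_isEmpty {w : Word d} (hw : ∀ a ∈ w, DEdge.inv a ∉ w) : IsEmpty (InvIdx [w]) := by
  refine ⟨fun o => ?_⟩
  obtain ⟨⟨i, hi⟩, ⟨⟨x, y⟩, hget⟩⟩ := o
  have hi0 : i = 0 := by simp only [List.length_singleton] at hi; omega
  subst hi0
  change w.get y = DEdge.inv (w.get x) at hget
  exact hw _ (List.get_mem w x) (hget ▸ List.get_mem w y)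

/-- `𝕊⁺((w))` is empty when the letters of `w` are pairwise distinct. [cite: Chatterjee2019LargeN, §2.2 (𝕊⁺(s))] -/
theorem sameIdx_isEmpty {w : Word d} (hw : w.Nodup) : IsEmpty (SameIdx [w]) := by
  refine ⟨fun o => ?_⟩
  obtain ⟨x, y, ⟨hxy, hget⟩, -⟩ := sameIdx_elim o
  exact hxy ((List.nodup_iff_injective_get.1 hw) hget).symm

/-- `a₁` of a one-word replacement that is a unit loop is `1`. [cite: Chatterjee2019LargeN, §4 (a₁ = 1), Lemma 11.3] -/
theorem coeffA_replaceAt_one_eq_one {w r : Word d} {q'' : ZdPlaquette d} (hr : IsUnitLoop q'' r) :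
    coeffA (LoopSeq.replaceAt [w] 0 [r]) 1 = 1 := by
  rw [replaceAt_singleton_zero, if_neg hr.ne_nil]
  exact hr.coeffA_one

/-- `a₁` of a one-word replacement whose 1-chain is not a unit chain is `0`. [cite: Chatterjee2019LargeN, Corollary 10.4 (k = 1), §14] -/
theorem coeffA_replaceAt_one_eq_zero {w r : Word d} (hr : IsLoop r)
    (h : ∀ (q'' : ZdPlaquette d) (ρ : ℤ), ρ = 1 ∨ ρ = -1 → wordChain r ≠ ρ • plaquetteChain q'') :
    coeffA (LoopSeq.replaceAt [w] 0 [r]) 1 = 0 := by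
  rw [replaceAt_singleton_zero]
  split_ifs with h0
  · exact coeffA_nil_of_pos le_rfl
  · exact coeffA_singleton_one_eq_zero_of_wordChain hr h0 h

/-! ### The 1-chains of the configuration -/

/-- `r(w₆) = r(P) − r(Q)`, `r(w₈) = r(P) + r(Q)`, `r(Q⁻¹) = −r(Q)`, `r(M) = −r(Q)`.
[cite: Chatterjee2019LargeN, §14 (proof of Lemma 14.1)] -/
theorem chains (hP : IsUnitLoop p [e, b₂, b₃, b₄]) (hQ : IsUnitLoop q [e, c₂, c₃, c₄]) (hpq : p ≠ q) :
    wordChain [DEdge.inv c₄, DEdge.inv c₃, DEdge.inv c₂, b₂, b₃, b₄] = wordChain [e, b₂, b₃, b₄] - wordChain [e, c₂, c₃, c₄] ∧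
    wordChain [e, c₂, c₃, c₄, e, b₂, b₃, b₄] = wordChain [e, b₂, b₃, b₄] + wordChain [e, c₂, c₃, c₄] ∧
    wordChain [DEdge.inv c₄, DEdge.inv c₃, DEdge.inv c₂, DEdge.inv e] = -wordChain [e, c₂, c₃, c₄] ∧
    wordChain [DEdge.inv e, DEdge.inv c₄, DEdge.inv c₃, DEdge.inv c₂] = -wordChain [e, c₂, c₃, c₄] := by
  refine ⟨?_, ?_, ?_, ?_⟩
  · rw [← negDeform_P_q hP hQ hpq, hQ.wordChain_negDeform ⟨0, by simp⟩ ⟨0, by simp⟩ (t := [b₂, b₃, b₄]) rfl]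
  · rw [← posDeform_P_q hP hQ hpq, hQ.wordChain_posDeform ⟨0, by simp⟩ ⟨0, by simp⟩ (t := [b₂, b₃, b₄]) rfl]
  · rw [← invRev_four, wordChain_invRev]
  · rw [← wordChain_rotate [e, c₂, c₃, c₄] 1, show [e, c₂, c₃, c₄].rotate 1 = [c₂, c₃, c₄, e] from rfl,
      ← invRev_four, wordChain_invRev]

/-! ### `a₂(w₆) = 1`: the deformation terms -/

/-- The negative-deformation terms of the first-move recursion for `w₆` at order `2`: at a `q`-letter only
`q' = q` contributes (`w₆ ⊖ q = P`, `a₁ = 1`), at a `p`-letter only `q' = p` (`w₆ ⊖ p = M`); every other `q'`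
gives a loop whose 1-chain `±δp ± δq ± δq'` is not a unit chain. [cite: Chatterjee2019LargeN, Corollary 10.4, §14] -/
theorem eval_neg_w6 (hP : IsUnitLoop p [e, b₂, b₃, b₄]) (hQ : IsUnitLoop q [e, c₂, c₃, c₄]) (hpq : p ≠ q)
    (y : Fin [DEdge.inv c₄, DEdge.inv c₃, DEdge.inv c₂, b₂, b₃, b₄].length) (q' : ZdPlaquette d)
    (hq' : q' ∈ plaquettesAt ([DEdge.inv c₄, DEdge.inv c₃, DEdge.inv c₂, b₂, b₃, b₄].get y)) :
    coeffA (LoopSeq.replaceAt [[DEdge.inv c₄, DEdge.inv c₃, DEdge.inv c₂, b₂, b₃, b₄]] 0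
      [Word.negDeform [DEdge.inv c₄, DEdge.inv c₃, DEdge.inv c₂, b₂, b₃, b₄] y q']) 1
      = if q' = (if (y : ℕ) < 3 then q else p) then 1 else 0 := by
  classical
  obtain ⟨τP, hτP, hcP⟩ := hP.wordChain_eq
  obtain ⟨τQ, hτQ, hcQ⟩ := hQ.wordChain_eq
  obtain ⟨h6, -, -, -⟩ := chains hP hQ hpq
  have hloop := isLoop_w6 hP hQ hpq
  -- the generic term: `q' ∉ {p, q}` contributes `0`
  have other : q' ≠ p → q' ≠ q → coeffA (LoopSeq.replaceAt [[DEdge.inv c₄, DEdge.inv c₃, DEdge.inv c₂, b₂, b₃, b₄]] 0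
      [Word.negDeform [DEdge.inv c₄, DEdge.inv c₃, DEdge.inv c₂, b₂, b₃, b₄] y q']) 1 = 0 := by
    intro hqp hqq
    refine coeffA_replaceAt_one_eq_zero (Word.isLoop_negDeform hloop.1 y hq') fun q'' ρ hρ hc => ?_
    obtain ⟨σ, hσ, hσc⟩ := Word.wordChain_negDeform _ y hq'
    rw [hσc, h6, hcP, hcQ, sub_eq_add_neg, ← neg_smul] at hc
    rcases mem_pair_of_chain_eq hpq hτP (by rcases hτQ with h | h <;> simp [h]) hσ ρ hc with h | h
    · exact hqp h
    · exact hqq h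
  have hcq : ∀ {c : DEdge d}, c = c₂ ∨ c = c₃ ∨ c = c₄ → q' ∈ plaquettesAt (DEdge.inv c) → q' ≠ p := by
    intro c hc hmem h
    rw [mem_plaquettesAt_iff] at hmem
    exact fst_not_mem_of_two_units hQ hP hpq.symm hc (h ▸ hmem)
  have hbq : ∀ {b : DEdge d}, b = b₂ ∨ b = b₃ ∨ b = b₄ → q' ∈ plaquettesAt b → q' ≠ q := by
    intro b hb hmem h
    rw [mem_plaquettesAt_iff] at hmem
    exact fst_not_mem_of_two_units hP hQ hpq hb (h ▸ hmem)
  obtain ⟨y, hy⟩ := y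
  have hy6 : y < 6 := by simpa using hy
  interval_cases y
  · have hqp : q' ≠ p := hcq (Or.inr (Or.inr rfl)) hq'
    by_cases hqq : q' = q
    · subst hqq; rw [negDeform_w6_0 hP hQ, coeffA_replaceAt_one_eq_one hP]; simp
    · rw [other hqp hqq]; simp [hqq]
  · have hqp : q' ≠ p := hcq (Or.inr (Or.inl rfl)) hq'
    by_cases hqq : q' = q
    · subst hqq; rw [negDeform_w6_1 hP hQ hpq, coeffA_replaceAt_one_eq_one hP]; simp
    · rw [other hqp hqq]; simp [hqq]
  · have hqp : q' ≠ p := hcq (Or.inl rfl) hq'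
    by_cases hqq : q' = q
    · subst hqq; rw [negDeform_w6_2 hP hQ hpq, coeffA_replaceAt_one_eq_one hP]; simp
    · rw [other hqp hqq]; simp [hqq]
  · have hqq : q' ≠ q := hbq (Or.inl rfl) hq'
    by_cases hqp : q' = p
    · subst hqp; rw [negDeform_w6_3 hP hQ, coeffA_replaceAt_one_eq_one (unit_M hQ)]; simp
    · rw [other hqp hqq]; simp [hqp]
  · have hqq : q' ≠ q := hbq (Or.inr (Or.inl rfl)) hq'
    by_cases hqp : q' = p
    · subst hqp; rw [negDeform_w6_4 hP hQ hpq, coeffA_replaceAt_one_eq_one (unit_M hQ)]; simp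
    · rw [other hqp hqq]; simp [hqp]
  · have hqq : q' ≠ q := hbq (Or.inr (Or.inr rfl)) hq'
    by_cases hqp : q' = p
    · subst hqp; rw [negDeform_w6_5 hP hQ hpq, coeffA_replaceAt_one_eq_one (unit_M hQ)]; simp
    · rw [other hqp hqq]; simp [hqp]

/-- All positive-deformation terms of the first-move recursion for `w₆` at order `2` vanish: `w₆ ⊕ q'` has
1-chain `r(P) − 2r(Q)`, `2r(P) − r(Q)` or `r(P) − r(Q) ± δq'` (`q' ∉ {p, q}`), never a unit chain.
[cite: Chatterjee2019LargeN, Corollary 10.4, §14] -/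
theorem eval_pos_w6 (hP : IsUnitLoop p [e, b₂, b₃, b₄]) (hQ : IsUnitLoop q [e, c₂, c₃, c₄]) (hpq : p ≠ q)
    (y : Fin [DEdge.inv c₄, DEdge.inv c₃, DEdge.inv c₂, b₂, b₃, b₄].length) (q' : ZdPlaquette d) (hq' : q' ∈ plaquettesAt ([DEdge.inv c₄, DEdge.inv c₃, DEdge.inv c₂, b₂, b₃, b₄].get y)) :
    coeffA (LoopSeq.replaceAt [[DEdge.inv c₄, DEdge.inv c₃, DEdge.inv c₂, b₂, b₃, b₄]] 0 [Word.posDeform [DEdge.inv c₄, DEdge.inv c₃, DEdge.inv c₂, b₂, b₃, b₄] y q']) 1 = 0 := by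
  classical
  obtain ⟨τP, hτP, hcP⟩ := hP.wordChain_eq
  obtain ⟨τQ, hτQ, hcQ⟩ := hQ.wordChain_eq
  obtain ⟨h6, -, hiQ, -⟩ := chains hP hQ hpq
  have hloop := isLoop_w6 hP hQ hpq
  have hτQ' : -τQ = 1 ∨ -τQ = -1 := by rcases hτQ with h | h <;> simp [h]
  refine coeffA_replaceAt_one_eq_zero (Word.isLoop_posDeform hloop.1 y hq') fun q'' ρ _ hc => ?_
  have other : q' ≠ p → q' ≠ q → False := by
    intro hqp hqq
    obtain ⟨σ, hσ, hσc⟩ := Word.wordChain_posDeform _ y hq'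
    rw [hσc, h6, hcP, hcQ, sub_eq_add_neg, ← neg_smul] at hc
    rcases mem_pair_of_chain_eq hpq hτP hτQ' hσ ρ hc with h | h
    · exact hqp h
    · exact hqq h
  have hcq : ∀ {c : DEdge d}, c = c₂ ∨ c = c₃ ∨ c = c₄ → q' ∈ plaquettesAt (DEdge.inv c) → q' ≠ p := by
    intro c hc' hmem h
    rw [mem_plaquettesAt_iff] at hmem
    exact fst_not_mem_of_two_units hQ hP hpq.symm hc' (h ▸ hmem)
  have hbq : ∀ {b : DEdge d}, b = b₂ ∨ b = b₃ ∨ b = b₄ → q' ∈ plaquettesAt b → q' ≠ q := by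
    intro b hb hmem h
    rw [mem_plaquettesAt_iff] at hmem
    exact fst_not_mem_of_two_units hP hQ hpq hb (h ▸ hmem)
  -- `q' = q` at a `q`-letter: the inserted loop is a rotation of `Q⁻¹`, total chain `r(P) − 2 r(Q)`
  have caseQ : ∀ (t : Word d) (j : Fin [DEdge.inv c₄, DEdge.inv c₃, DEdge.inv c₂, DEdge.inv e].length),
      [DEdge.inv c₄, DEdge.inv c₃, DEdge.inv c₂, b₂, b₃, b₄].rotate y = [DEdge.inv c₄, DEdge.inv c₃, DEdge.inv c₂, DEdge.inv e].get j :: t → q' = q → False := by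
    intro t j hrot hqq
    subst hqq
    rw [(unit_invQ hQ).wordChain_posDeform j y hrot, h6, hiQ, hcP, hcQ] at hc
    refine chain_ne_of_double (q'' := q'') hpq hτP hτQ' ρ ?_
    rw [← hc, two_mul, add_smul, neg_smul]; abel
  -- `q' = p` at a `p`-letter: the inserted loop is a rotation of `P`, total chain `2 r(P) − r(Q)`
  have caseP : ∀ (t : Word d) (j : Fin [e, b₂, b₃, b₄].length),
      [DEdge.inv c₄, DEdge.inv c₃, DEdge.inv c₂, b₂, b₃, b₄].rotate y = [e, b₂, b₃, b₄].get j :: t → q' = p → False := by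
    intro t j hrot hqp
    subst hqp
    rw [hP.wordChain_posDeform j y hrot, h6, hcP, hcQ] at hc
    refine chain_ne_of_double (q'' := q'') (Ne.symm hpq) hτQ' hτP ρ ?_
    rw [← hc, two_mul, add_smul, neg_smul, sub_eq_add_neg]; abel
  obtain ⟨y, hy⟩ := y
  have hy6 : y < 6 := by simpa using hy
  interval_cases y
  · by_cases hqq : q' = q
    · exact caseQ [DEdge.inv c₃, DEdge.inv c₂, b₂, b₃, b₄] ⟨0, by simp⟩ rfl hqq
    · exact other (hcq (Or.inr (Or.inr rfl)) hq') hqq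
  · by_cases hqq : q' = q
    · exact caseQ [DEdge.inv c₂, b₂, b₃, b₄, DEdge.inv c₄] ⟨1, by simp⟩ rfl hqq
    · exact other (hcq (Or.inr (Or.inl rfl)) hq') hqq
  · by_cases hqq : q' = q
    · exact caseQ [b₂, b₃, b₄, DEdge.inv c₄, DEdge.inv c₃] ⟨2, by simp⟩ rfl hqq
    · exact other (hcq (Or.inl rfl) hq') hqq
  · by_cases hqp : q' = p
    · exact caseP [b₃, b₄, DEdge.inv c₄, DEdge.inv c₃, DEdge.inv c₂] ⟨1, by simp⟩ rfl hqp
    · exact other hqp (hbq (Or.inl rfl) hq')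
  · by_cases hqp : q' = p
    · exact caseP [b₄, DEdge.inv c₄, DEdge.inv c₃, DEdge.inv c₂, b₂] ⟨2, by simp⟩ rfl hqp
    · exact other hqp (hbq (Or.inr (Or.inl rfl)) hq')
  · by_cases hqp : q' = p
    · exact caseP [DEdge.inv c₄, DEdge.inv c₃, DEdge.inv c₂, b₂, b₃] ⟨3, by simp⟩ rfl hqp
    · exact other hqp (hbq (Or.inr (Or.inr rfl)) hq')

/-- The letters of `w₆` are pairwise distinct and none occurs inverted. [cite: Chatterjee2019LargeN, §2.2] -/
theorem letters_w6 (hP : IsUnitLoop p [e, b₂, b₃, b₄]) (hQ : IsUnitLoop q [e, c₂, c₃, c₄]) (hpq : p ≠ q) :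
    [DEdge.inv c₄, DEdge.inv c₃, DEdge.inv c₂, b₂, b₃, b₄].Nodup ∧ ∀ a ∈ [DEdge.inv c₄, DEdge.inv c₃, DEdge.inv c₂, b₂, b₃, b₄], DEdge.inv a ∉ [DEdge.inv c₄, DEdge.inv c₃, DEdge.inv c₂, b₂, b₃, b₄] := by
  obtain ⟨⟨-, ⟨hb23, hb24⟩, hb34⟩, ⟨-, ⟨hc23, hc24⟩, hc34⟩,
    ⟨⟨h22, h23, h24⟩, ⟨h32, h33, h34⟩, ⟨h42, h43, h44⟩⟩⟩ := distinct hP hQ hpq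
  refine ⟨List.Nodup.of_map Prod.fst ?_, ?_⟩
  · simp [DEdge.inv, hb23, hb24, hb34, hc23.symm, hc24.symm, hc34.symm, h22.symm, h23.symm, h24.symm, h32.symm,
      h33.symm, h34.symm, h42.symm, h43.symm, h44.symm]
  · intro a ha
    simp only [List.mem_cons, List.not_mem_nil, or_false] at ha
    rcases ha with rfl | rfl | rfl | rfl | rfl | rfl <;>
      simp [DEdge.inv, Prod.ext_iff, hb23, hb24, hb34, hc23, hc24, hc34, h22, h23, h24, h32, h33, h34, h42,
        h43, h44, hb23.symm, hb24.symm, hb34.symm, hc23.symm, hc24.symm, hc34.symm, h22.symm, h23.symm,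
        h24.symm, h32.symm, h33.symm, h34.symm, h42.symm, h43.symm, h44.symm]

/-- `Σ_{𝔻⁻((w₆))} a₁ = 6`. [cite: Chatterjee2019LargeN, Corollary 10.4 (k = 2 for w₆)] -/
theorem sum_neg_w6 (hP : IsUnitLoop p [e, b₂, b₃, b₄]) (hQ : IsUnitLoop q [e, c₂, c₃, c₄]) (hpq : p ≠ q) :
    ∑ o : DeformIdx [[DEdge.inv c₄, DEdge.inv c₃, DEdge.inv c₂, b₂, b₃, b₄]], coeffA (LoopSeq.negDeformAt [[DEdge.inv c₄, DEdge.inv c₃, DEdge.inv c₂, b₂, b₃, b₄]] o) 1 = 6 := by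
  classical
  have hpt : ∀ o : DeformIdx [[DEdge.inv c₄, DEdge.inv c₃, DEdge.inv c₂, b₂, b₃, b₄]], coeffA (LoopSeq.negDeformAt [[DEdge.inv c₄, DEdge.inv c₃, DEdge.inv c₂, b₂, b₃, b₄]] o) 1
      = if o.2.2.1 = (if (o.2.1 : ℕ) < 3 then q else p) then 1 else 0 := by
    intro o
    obtain ⟨y, q', hq', rfl⟩ := deformIdx_elim o
    exact eval_neg_w6 hP hQ hpq y q' hq'
  rw [Finset.sum_congr rfl fun o _ => hpt o, Finset.sum_boole]
  have hmem : ∀ y : Fin [DEdge.inv c₄, DEdge.inv c₃, DEdge.inv c₂, b₂, b₃, b₄].length, (if (y : ℕ) < 3 then q else p) ∈ plaquettesAt ([DEdge.inv c₄, DEdge.inv c₃, DEdge.inv c₂, b₂, b₃, b₄].get y) := by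
    rintro ⟨y, hy⟩
    have hy6 : y < 6 := by simpa using hy
    interval_cases y
    · exact (unit_invQ hQ).mem_plaquettesAt (by simp)
    · exact (unit_invQ hQ).mem_plaquettesAt (by simp)
    · exact (unit_invQ hQ).mem_plaquettesAt (by simp)
    · exact hP.mem_plaquettesAt (by simp)
    · exact hP.mem_plaquettesAt (by simp)
    · exact hP.mem_plaquettesAt (by simp)
  let f : Fin [DEdge.inv c₄, DEdge.inv c₃, DEdge.inv c₂, b₂, b₃, b₄].length → DeformIdx [[DEdge.inv c₄, DEdge.inv c₃, DEdge.inv c₂, b₂, b₃, b₄]] := fun y => ⟨⟨0, Nat.zero_lt_one⟩, y, ⟨_, hmem y⟩⟩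
  have hf : Function.Injective f := by
    intro a b hab
    simp only [f, Sigma.mk.injEq, heq_eq_eq, true_and] at hab
    exact hab.1
  have hset : (Finset.univ.filter fun o : DeformIdx [[DEdge.inv c₄, DEdge.inv c₃, DEdge.inv c₂, b₂, b₃, b₄]] => o.2.2.1 = if (o.2.1 : ℕ) < 3 then q else p)
      = Finset.univ.map ⟨f, hf⟩ := by
    ext o
    simp only [Finset.mem_filter, Finset.mem_univ, true_and, Finset.mem_map, Function.Embedding.coeFn_mk]
    constructor
    · intro ho
      obtain ⟨y, q', hq', rfl⟩ := deformIdx_elim o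
      have ho' : q' = if (y : ℕ) < 3 then q else p := ho
      subst ho'
      exact ⟨y, rfl⟩
    · rintro ⟨y, rfl⟩
      rfl
  rw [hset, Finset.card_map, Finset.card_univ, Fintype.card_fin]
  norm_num

/-- `Σ_{𝔻⁺((w₆))} a₁ = 0`. [cite: Chatterjee2019LargeN, Corollary 10.4 (k = 2 for w₆)] -/
theorem sum_pos_w6 (hP : IsUnitLoop p [e, b₂, b₃, b₄]) (hQ : IsUnitLoop q [e, c₂, c₃, c₄]) (hpq : p ≠ q) :
    ∑ o : DeformIdx [[DEdge.inv c₄, DEdge.inv c₃, DEdge.inv c₂, b₂, b₃, b₄]], coeffA (LoopSeq.posDeformAt [[DEdge.inv c₄, DEdge.inv c₃, DEdge.inv c₂, b₂, b₃, b₄]] o) 1 = 0 := by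
  refine Finset.sum_eq_zero fun o _ => ?_
  obtain ⟨y, q', hq', rfl⟩ := deformIdx_elim o
  exact eval_pos_w6 hP hQ hpq y q' hq'

/-- ★ **`a₂(∂p ⊖ q) = 1`**: `6·a₂(w₆) = 0 − 0 + (6 − 0)`. [cite: Chatterjee2019LargeN, Corollary 10.4, §4] -/
theorem coeffA_w6_two (hP : IsUnitLoop p [e, b₂, b₃, b₄]) (hQ : IsUnitLoop q [e, c₂, c₃, c₄]) (hpq : p ≠ q) :
    coeffA [[DEdge.inv c₄, DEdge.inv c₃, DEdge.inv c₂, b₂, b₃, b₄]] 2 = 1 := by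
  classical
  have h := Factorization.len_mul_coeffA (s := [[DEdge.inv c₄, DEdge.inv c₃, DEdge.inv c₂, b₂, b₃, b₄]]) (List.cons_ne_nil _ _) (by simp [LoopSeq.len]) 2
  haveI : IsEmpty (InvIdx [[DEdge.inv c₄, DEdge.inv c₃, DEdge.inv c₂, b₂, b₃, b₄]]) := invIdx_isEmpty (letters_w6 hP hQ hpq).2
  haveI : IsEmpty (SameIdx [[DEdge.inv c₄, DEdge.inv c₃, DEdge.inv c₂, b₂, b₃, b₄]]) := sameIdx_isEmpty (letters_w6 hP hQ hpq).1
  rw [Fintype.sum_empty, Fintype.sum_empty, if_pos one_le_two, sum_neg_w6 hP hQ hpq, sum_pos_w6 hP hQ hpq] at h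
  have hl : (LoopSeq.len [[DEdge.inv c₄, DEdge.inv c₃, DEdge.inv c₂, b₂, b₃, b₄]] : ℝ) = 6 := by simp [LoopSeq.len]
  rw [hl] at h
  linarith

/-! ### `a₂(w₈) = 1`: the figure-eight `w₈ = e c₂c₃c₄ e b₂b₃b₄ = ∂p ⊕ q` -/

/-- A pair replacing the single component. [cite: Chatterjee2019LargeN, §2.2 (s' a splitting of s)] -/
theorem replaceAt_singleton_zero_pair (w u₁ u₂ : Word d) (h₁ : u₁ ≠ []) (h₂ : u₂ ≠ []) :
    LoopSeq.replaceAt [w] 0 [u₁, u₂] = [u₁, u₂] := by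
  rw [LoopSeq.replaceAt, LoopSeq.prune]
  simp [h₁, h₂]

/-- No letter of `w₈` occurs inverted in `w₈` (so `𝕊⁻((w₈)) = ∅`). [cite: Chatterjee2019LargeN, §2.2 (𝕊⁻(s))] -/
theorem letters_w8 (hP : IsUnitLoop p [e, b₂, b₃, b₄]) (hQ : IsUnitLoop q [e, c₂, c₃, c₄]) (hpq : p ≠ q) :
    ∀ a ∈ [e, c₂, c₃, c₄, e, b₂, b₃, b₄], DEdge.inv a ∉ [e, c₂, c₃, c₄, e, b₂, b₃, b₄] := by
  obtain ⟨⟨⟨heb2, heb3, heb4⟩, ⟨hb23, hb24⟩, hb34⟩, ⟨⟨hec2, hec3, hec4⟩, ⟨hc23, hc24⟩, hc34⟩,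
    ⟨⟨h22, h23, h24⟩, ⟨h32, h33, h34⟩, ⟨h42, h43, h44⟩⟩⟩ := distinct hP hQ hpq
  intro a ha
  simp only [List.mem_cons, List.not_mem_nil, or_false] at ha
  rcases ha with rfl | rfl | rfl | rfl | rfl | rfl | rfl | rfl <;>
    simp [DEdge.inv, Prod.ext_iff, heb2, heb3, heb4, hb23, hb24, hb34, hec2, hec3, hec4, hc23, hc24, hc34, h22, h23, h24, h32, h33, h34, h42, h43, h44, heb2.symm, heb3.symm, heb4.symm, hb23.symm, hb24.symm, hb34.symm, hec2.symm, hec3.symm, hec4.symm, hc23.symm, hc24.symm, hc34.symm, h22.symm, h23.symm, h24.symm, h32.symm, h33.symm, h34.symm, h42.symm, h43.symm, h44.symm]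

/-- `𝕊⁺((w₈))` consists of the two ordered pairs of `e`-locations `(0, 4)` and `(4, 0)`, splitting `w₈` into
`(P, c₂c₃c₄e)` resp. `(Q, b₂b₃b₄e)`. [cite: Chatterjee2019LargeN, §2.2 (positive splitting), §4] -/
theorem sameIdx_w8 (hP : IsUnitLoop p [e, b₂, b₃, b₄]) (hQ : IsUnitLoop q [e, c₂, c₃, c₄]) (hpq : p ≠ q) :
    ∃ o₁ o₂ : SameIdx [[e, c₂, c₃, c₄, e, b₂, b₃, b₄]], o₁ ≠ o₂ ∧ (∀ o, o = o₁ ∨ o = o₂) ∧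
      LoopSeq.posSplitAt [[e, c₂, c₃, c₄, e, b₂, b₃, b₄]] o₁ = [[e, b₂, b₃, b₄], [c₂, c₃, c₄, e]] ∧
      LoopSeq.posSplitAt [[e, c₂, c₃, c₄, e, b₂, b₃, b₄]] o₂ = [[e, c₂, c₃, c₄], [b₂, b₃, b₄, e]] := by
  obtain ⟨⟨⟨heb2, heb3, heb4⟩, ⟨hb23, hb24⟩, hb34⟩, ⟨⟨hec2, hec3, hec4⟩, ⟨hc23, hc24⟩, hc34⟩,
    ⟨⟨h22, h23, h24⟩, ⟨h32, h33, h34⟩, ⟨h42, h43, h44⟩⟩⟩ := distinct hP hQ hpq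
  refine ⟨⟨⟨0, Nat.zero_lt_one⟩, ⟨(⟨0, by simp⟩, ⟨4, by simp⟩), by simp, rfl⟩⟩,
    ⟨⟨0, Nat.zero_lt_one⟩, ⟨(⟨4, by simp⟩, ⟨0, by simp⟩), by simp, rfl⟩⟩, by simp, ?_, ?_, ?_⟩
  · intro o
    obtain ⟨⟨x, hx⟩, ⟨y, hy⟩, ⟨hxy, hget⟩, rfl⟩ := sameIdx_elim o
    have hl := hget
    simp only [List.get_eq_getElem] at hl
    have hx8 : x < 8 := by simpa using hx
    have hy8 : y < 8 := by simpa using hy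
    interval_cases x <;> interval_cases y <;>
      simp only [List.getElem_cons_zero, List.getElem_cons_succ] at hl <;>
      first
        | exact (hxy rfl).elim
        | exact Or.inl rfl
        | exact Or.inr rfl
        | exact absurd (congrArg Prod.fst hl) (by assumption)
        | exact absurd (congrArg Prod.fst hl).symm (by assumption)
  · show LoopSeq.replaceAt [[e, c₂, c₃, c₄, e, b₂, b₃, b₄]] 0 [Word.posSplit₁ [e, c₂, c₃, c₄, e, b₂, b₃, b₄] ⟨0, _⟩ ⟨4, _⟩, Word.posSplit₂ [e, c₂, c₃, c₄, e, b₂, b₃, b₄] ⟨0, _⟩ ⟨4, _⟩] = _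
    rw [(posSplit_w8_04 hP hQ).1, (posSplit_w8_04 hP hQ).2]
    exact replaceAt_singleton_zero_pair _ _ _ hP.ne_nil (unit_rot1 hQ).ne_nil
  · show LoopSeq.replaceAt [[e, c₂, c₃, c₄, e, b₂, b₃, b₄]] 0 [Word.posSplit₁ [e, c₂, c₃, c₄, e, b₂, b₃, b₄] ⟨4, _⟩ ⟨0, _⟩, Word.posSplit₂ [e, c₂, c₃, c₄, e, b₂, b₃, b₄] ⟨4, _⟩ ⟨0, _⟩] = _
    rw [(posSplit_w8_40 hP hQ).1, (posSplit_w8_40 hP hQ).2]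
    exact replaceAt_singleton_zero_pair _ _ _ hQ.ne_nil (unit_rot1 hP).ne_nil

/-- `Σ_{𝕊⁺((w₈))} a₂ = 2`: both splittings give a pair of unit loops (`a₂ = a₁·a₁ = 1`, Lemma 11.3).
[cite: Chatterjee2019LargeN, Corollary 10.4, Lemma 11.3, §4] -/
theorem sum_same_w8 (hP : IsUnitLoop p [e, b₂, b₃, b₄]) (hQ : IsUnitLoop q [e, c₂, c₃, c₄]) (hpq : p ≠ q) :
    ∑ o : SameIdx [[e, c₂, c₃, c₄, e, b₂, b₃, b₄]], coeffA (LoopSeq.posSplitAt [[e, c₂, c₃, c₄, e, b₂, b₃, b₄]] o) 2 = 2 := by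
  classical
  obtain ⟨o₁, o₂, hne, hall, h₁, h₂⟩ := sameIdx_w8 hP hQ hpq
  have huniv : (Finset.univ : Finset (SameIdx [[e, c₂, c₃, c₄, e, b₂, b₃, b₄]])) = {o₁, o₂} := by
    ext o
    simp only [Finset.mem_univ, Finset.mem_insert, Finset.mem_singleton, true_iff]
    exact hall o
  rw [huniv, Finset.sum_pair hne, h₁, h₂, coeffA_pair_two hP (unit_rot1 hQ), coeffA_pair_two hQ (unit_rot1 hP)]
  norm_num

/-- The negative-deformation terms for `w₈` at order `2`: at each of the `8` locations the deformation by
the plaquette of the letter's own loop gives a unit loop (`a₁ = 1`), and at the two `e`-locations ALSO the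
deformation by the other plaquette does (`w₈ ⊖₀ p = c₂c₃c₄e`, `w₈ ⊖₄ q = b₂b₃b₄e`); everything else has a
non-unit 1-chain. [cite: Chatterjee2019LargeN, Corollary 10.4, §14] -/
theorem eval_neg_w8 (hP : IsUnitLoop p [e, b₂, b₃, b₄]) (hQ : IsUnitLoop q [e, c₂, c₃, c₄]) (hpq : p ≠ q)
    (y : Fin [e, c₂, c₃, c₄, e, b₂, b₃, b₄].length) (q' : ZdPlaquette d) (hq' : q' ∈ plaquettesAt ([e, c₂, c₃, c₄, e, b₂, b₃, b₄].get y)) :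
    coeffA (LoopSeq.replaceAt [[e, c₂, c₃, c₄, e, b₂, b₃, b₄]] 0 [Word.negDeform [e, c₂, c₃, c₄, e, b₂, b₃, b₄] y q']) 1
      = (if q' = (if (y : ℕ) < 4 then q else p) then 1 else 0)
        + (if ((y : ℕ) = 0 ∨ (y : ℕ) = 4) ∧ q' = (if (y : ℕ) < 4 then p else q) then 1 else 0) := by
  classical
  obtain ⟨τP, hτP, hcP⟩ := hP.wordChain_eq
  obtain ⟨τQ, hτQ, hcQ⟩ := hQ.wordChain_eq
  obtain ⟨-, h8, -, -⟩ := chains hP hQ hpq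
  have hloop := isLoop_w8 hP hQ hpq
  have other : q' ≠ p → q' ≠ q →
      coeffA (LoopSeq.replaceAt [[e, c₂, c₃, c₄, e, b₂, b₃, b₄]] 0 [Word.negDeform [e, c₂, c₃, c₄, e, b₂, b₃, b₄] y q']) 1 = 0 := by
    intro hqp hqq
    refine coeffA_replaceAt_one_eq_zero (Word.isLoop_negDeform hloop.1 y hq') fun q'' ρ _ hc => ?_
    obtain ⟨σ, hσ, hσc⟩ := Word.wordChain_negDeform _ y hq'
    rw [hσc, h8, hcP, hcQ] at hc
    rcases mem_pair_of_chain_eq hpq hτP hτQ hσ ρ hc with h | h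
    · exact hqp h
    · exact hqq h
  have hcq : ∀ {c : DEdge d}, c = c₂ ∨ c = c₃ ∨ c = c₄ → q' ∈ plaquettesAt c → q' ≠ p := by
    intro c hc' hmem h
    rw [mem_plaquettesAt_iff] at hmem
    exact fst_not_mem_of_two_units hQ hP hpq.symm hc' (h ▸ hmem)
  have hbq : ∀ {b : DEdge d}, b = b₂ ∨ b = b₃ ∨ b = b₄ → q' ∈ plaquettesAt b → q' ≠ q := by
    intro b hb hmem h
    rw [mem_plaquettesAt_iff] at hmem
    exact fst_not_mem_of_two_units hP hQ hpq hb (h ▸ hmem)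
  obtain ⟨y, hy⟩ := y
  have hy8 : y < 8 := by simpa using hy
  interval_cases y
  · by_cases hqq : q' = q
    · subst hqq
      rw [negDeform_w8_0q hP hQ, coeffA_replaceAt_one_eq_one hP]
      simp [Ne.symm hpq]
    · by_cases hqp : q' = p
      · subst hqp
        rw [negDeform_w8_0p hP hQ hpq, coeffA_replaceAt_one_eq_one (unit_rot1 hQ)]
        simp [hpq]
      · rw [other hqp hqq]; simp [hqq, hqp]
  · have hqp : q' ≠ p := hcq (Or.inl rfl) hq'
    by_cases hqq : q' = q
    · subst hqq
      rw [negDeform_w8_1q hP hQ, coeffA_replaceAt_one_eq_one (unit_rot1 hP)]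
      simp
    · rw [other hqp hqq]; simp [hqq]
  · have hqp : q' ≠ p := hcq (Or.inr (Or.inl rfl)) hq'
    by_cases hqq : q' = q
    · subst hqq
      rw [negDeform_w8_2q hP hQ hpq, coeffA_replaceAt_one_eq_one (unit_rot1 hP)]
      simp
    · rw [other hqp hqq]; simp [hqq]
  · have hqp : q' ≠ p := hcq (Or.inr (Or.inr rfl)) hq'
    by_cases hqq : q' = q
    · subst hqq
      rw [negDeform_w8_3q hP hQ hpq, coeffA_replaceAt_one_eq_one (unit_rot1 hP)]
      simp
    · rw [other hqp hqq]; simp [hqq]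
  · have hr : [e, c₂, c₃, c₄, e, b₂, b₃, b₄].rotate ((⟨4, hy⟩ : Fin [e, c₂, c₃, c₄, e, b₂, b₃, b₄].length) : ℕ)
        = [e, b₂, b₃, b₄, e, c₂, c₃, c₄].rotate ((⟨0, by simp⟩ : Fin [e, b₂, b₃, b₄, e, c₂, c₃, c₄].length) : ℕ) := rfl
    by_cases hqp : q' = p
    · subst hqp
      rw [negDeform_eq_of_rotate_eq hr, negDeform_w8_0q hQ hP, coeffA_replaceAt_one_eq_one hQ]
      simp [hpq]
    · by_cases hqq : q' = q
      · subst hqq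
        rw [negDeform_eq_of_rotate_eq hr, negDeform_w8_0p hQ hP (Ne.symm hpq),
          coeffA_replaceAt_one_eq_one (unit_rot1 hP)]
        simp [Ne.symm hpq]
      · rw [other hqp hqq]; simp [hqq, hqp]
  · have hqq : q' ≠ q := hbq (Or.inl rfl) hq'
    have hr : [e, c₂, c₃, c₄, e, b₂, b₃, b₄].rotate ((⟨5, hy⟩ : Fin [e, c₂, c₃, c₄, e, b₂, b₃, b₄].length) : ℕ)
        = [e, b₂, b₃, b₄, e, c₂, c₃, c₄].rotate ((⟨1, by simp⟩ : Fin [e, b₂, b₃, b₄, e, c₂, c₃, c₄].length) : ℕ) := rfl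
    by_cases hqp : q' = p
    · subst hqp
      rw [negDeform_eq_of_rotate_eq hr, negDeform_w8_1q hQ hP, coeffA_replaceAt_one_eq_one (unit_rot1 hQ)]
      simp
    · rw [other hqp hqq]; simp [hqp]
  · have hqq : q' ≠ q := hbq (Or.inr (Or.inl rfl)) hq'
    have hr : [e, c₂, c₃, c₄, e, b₂, b₃, b₄].rotate ((⟨6, hy⟩ : Fin [e, c₂, c₃, c₄, e, b₂, b₃, b₄].length) : ℕ)
        = [e, b₂, b₃, b₄, e, c₂, c₃, c₄].rotate ((⟨2, by simp⟩ : Fin [e, b₂, b₃, b₄, e, c₂, c₃, c₄].length) : ℕ) := rfl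
    by_cases hqp : q' = p
    · subst hqp
      rw [negDeform_eq_of_rotate_eq hr, negDeform_w8_2q hQ hP (Ne.symm hpq),
        coeffA_replaceAt_one_eq_one (unit_rot1 hQ)]
      simp
    · rw [other hqp hqq]; simp [hqp]
  · have hqq : q' ≠ q := hbq (Or.inr (Or.inr rfl)) hq'
    have hr : [e, c₂, c₃, c₄, e, b₂, b₃, b₄].rotate ((⟨7, hy⟩ : Fin [e, c₂, c₃, c₄, e, b₂, b₃, b₄].length) : ℕ)
        = [e, b₂, b₃, b₄, e, c₂, c₃, c₄].rotate ((⟨3, by simp⟩ : Fin [e, b₂, b₃, b₄, e, c₂, c₃, c₄].length) : ℕ) := rfl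
    by_cases hqp : q' = p
    · subst hqp
      rw [negDeform_eq_of_rotate_eq hr, negDeform_w8_3q hQ hP (Ne.symm hpq),
        coeffA_replaceAt_one_eq_one (unit_rot1 hQ)]
      simp
    · rw [other hqp hqq]; simp [hqp]

/-- All positive-deformation terms for `w₈` at order `2` vanish (1-chains `r(P) + 2r(Q)`, `2r(P) + r(Q)`,
`r(P) + r(Q) ± δq'`). [cite: Chatterjee2019LargeN, Corollary 10.4, §14] -/
theorem eval_pos_w8 (hP : IsUnitLoop p [e, b₂, b₃, b₄]) (hQ : IsUnitLoop q [e, c₂, c₃, c₄]) (hpq : p ≠ q)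
    (y : Fin [e, c₂, c₃, c₄, e, b₂, b₃, b₄].length) (q' : ZdPlaquette d) (hq' : q' ∈ plaquettesAt ([e, c₂, c₃, c₄, e, b₂, b₃, b₄].get y)) :
    coeffA (LoopSeq.replaceAt [[e, c₂, c₃, c₄, e, b₂, b₃, b₄]] 0 [Word.posDeform [e, c₂, c₃, c₄, e, b₂, b₃, b₄] y q']) 1 = 0 := by
  classical
  obtain ⟨τP, hτP, hcP⟩ := hP.wordChain_eq
  obtain ⟨τQ, hτQ, hcQ⟩ := hQ.wordChain_eq
  obtain ⟨-, h8, -, -⟩ := chains hP hQ hpq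
  have hloop := isLoop_w8 hP hQ hpq
  refine coeffA_replaceAt_one_eq_zero (Word.isLoop_posDeform hloop.1 y hq') fun q'' ρ _ hc => ?_
  have other : q' ≠ p → q' ≠ q → False := by
    intro hqp hqq
    obtain ⟨σ, hσ, hσc⟩ := Word.wordChain_posDeform _ y hq'
    rw [hσc, h8, hcP, hcQ] at hc
    rcases mem_pair_of_chain_eq hpq hτP hτQ hσ ρ hc with h | h
    · exact hqp h
    · exact hqq h
  have hcq : ∀ {c : DEdge d}, c = c₂ ∨ c = c₃ ∨ c = c₄ → q' ∈ plaquettesAt c → q' ≠ p := by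
    intro c hc' hmem h
    rw [mem_plaquettesAt_iff] at hmem
    exact fst_not_mem_of_two_units hQ hP hpq.symm hc' (h ▸ hmem)
  have hbq : ∀ {b : DEdge d}, b = b₂ ∨ b = b₃ ∨ b = b₄ → q' ∈ plaquettesAt b → q' ≠ q := by
    intro b hb hmem h
    rw [mem_plaquettesAt_iff] at hmem
    exact fst_not_mem_of_two_units hP hQ hpq hb (h ▸ hmem)
  have caseQ : ∀ (t : Word d) (j : Fin [e, c₂, c₃, c₄].length),
      [e, c₂, c₃, c₄, e, b₂, b₃, b₄].rotate y = [e, c₂, c₃, c₄].get j :: t → q' = q → False := by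
    intro t j hrot hqq
    subst hqq
    rw [hQ.wordChain_posDeform j y hrot, h8, hcP, hcQ] at hc
    refine chain_ne_of_double (q'' := q'') hpq hτP hτQ ρ ?_
    rw [← hc, two_mul, add_smul]; abel
  have caseP : ∀ (t : Word d) (j : Fin [e, b₂, b₃, b₄].length),
      [e, c₂, c₃, c₄, e, b₂, b₃, b₄].rotate y = [e, b₂, b₃, b₄].get j :: t → q' = p → False := by
    intro t j hrot hqp
    subst hqp
    rw [hP.wordChain_posDeform j y hrot, h8, hcP, hcQ] at hc
    refine chain_ne_of_double (q'' := q'') (Ne.symm hpq) hτQ hτP ρ ?_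
    rw [← hc, two_mul, add_smul]; abel
  obtain ⟨y, hy⟩ := y
  have hy8 : y < 8 := by simpa using hy
  interval_cases y
  · by_cases hqq : q' = q
    · exact caseQ [c₂, c₃, c₄, e, b₂, b₃, b₄] ⟨0, by simp⟩ rfl hqq
    · by_cases hqp : q' = p
      · exact caseP [c₂, c₃, c₄, e, b₂, b₃, b₄] ⟨0, by simp⟩ rfl hqp
      · exact other hqp hqq
  · by_cases hqq : q' = q
    · exact caseQ [c₃, c₄, e, b₂, b₃, b₄, e] ⟨1, by simp⟩ rfl hqq
    · exact other (hcq (Or.inl rfl) hq') hqq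
  · by_cases hqq : q' = q
    · exact caseQ [c₄, e, b₂, b₃, b₄, e, c₂] ⟨2, by simp⟩ rfl hqq
    · exact other (hcq (Or.inr (Or.inl rfl)) hq') hqq
  · by_cases hqq : q' = q
    · exact caseQ [e, b₂, b₃, b₄, e, c₂, c₃] ⟨3, by simp⟩ rfl hqq
    · exact other (hcq (Or.inr (Or.inr rfl)) hq') hqq
  · by_cases hqq : q' = q
    · exact caseQ [b₂, b₃, b₄, e, c₂, c₃, c₄] ⟨0, by simp⟩ rfl hqq
    · by_cases hqp : q' = p
      · exact caseP [b₂, b₃, b₄, e, c₂, c₃, c₄] ⟨0, by simp⟩ rfl hqp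
      · exact other hqp hqq
  · by_cases hqp : q' = p
    · exact caseP [b₃, b₄, e, c₂, c₃, c₄, e] ⟨1, by simp⟩ rfl hqp
    · exact other hqp (hbq (Or.inl rfl) hq')
  · by_cases hqp : q' = p
    · exact caseP [b₄, e, c₂, c₃, c₄, e, b₂] ⟨2, by simp⟩ rfl hqp
    · exact other hqp (hbq (Or.inr (Or.inl rfl)) hq')
  · by_cases hqp : q' = p
    · exact caseP [e, c₂, c₃, c₄, e, b₂, b₃] ⟨3, by simp⟩ rfl hqp
    · exact other hqp (hbq (Or.inr (Or.inr rfl)) hq')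

/-- `Σ_{𝔻⁻((w₈))} a₁ = 10 = 8 + 2`. [cite: Chatterjee2019LargeN, Corollary 10.4 (k = 2 for w₈)] -/
theorem sum_neg_w8 (hP : IsUnitLoop p [e, b₂, b₃, b₄]) (hQ : IsUnitLoop q [e, c₂, c₃, c₄]) (hpq : p ≠ q) :
    ∑ o : DeformIdx [[e, c₂, c₃, c₄, e, b₂, b₃, b₄]], coeffA (LoopSeq.negDeformAt [[e, c₂, c₃, c₄, e, b₂, b₃, b₄]] o) 1 = 10 := by
  classical
  have hpt : ∀ o : DeformIdx [[e, c₂, c₃, c₄, e, b₂, b₃, b₄]], coeffA (LoopSeq.negDeformAt [[e, c₂, c₃, c₄, e, b₂, b₃, b₄]] o) 1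
      = (if o.2.2.1 = (if (o.2.1 : ℕ) < 4 then q else p) then 1 else 0)
        + (if ((o.2.1 : ℕ) = 0 ∨ (o.2.1 : ℕ) = 4) ∧ o.2.2.1 = (if (o.2.1 : ℕ) < 4 then p else q)
            then 1 else 0) := by
    intro o
    obtain ⟨y, q', hq', rfl⟩ := deformIdx_elim o
    exact eval_neg_w8 hP hQ hpq y q' hq'
  rw [Finset.sum_congr rfl fun o _ => hpt o, Finset.sum_add_distrib, Finset.sum_boole, Finset.sum_boole]
  -- the eight primary terms
  have hmem : ∀ y : Fin [e, c₂, c₃, c₄, e, b₂, b₃, b₄].length, (if (y : ℕ) < 4 then q else p) ∈ plaquettesAt ([e, c₂, c₃, c₄, e, b₂, b₃, b₄].get y) := by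
    rintro ⟨y, hy⟩
    have hy8 : y < 8 := by simpa using hy
    interval_cases y
    · exact hQ.mem_plaquettesAt (by simp)
    · exact hQ.mem_plaquettesAt (by simp)
    · exact hQ.mem_plaquettesAt (by simp)
    · exact hQ.mem_plaquettesAt (by simp)
    · exact hP.mem_plaquettesAt (by simp)
    · exact hP.mem_plaquettesAt (by simp)
    · exact hP.mem_plaquettesAt (by simp)
    · exact hP.mem_plaquettesAt (by simp)
  let f : Fin [e, c₂, c₃, c₄, e, b₂, b₃, b₄].length → DeformIdx [[e, c₂, c₃, c₄, e, b₂, b₃, b₄]] := fun y => ⟨⟨0, Nat.zero_lt_one⟩, y, ⟨_, hmem y⟩⟩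
  have hf : Function.Injective f := by
    intro a b hab
    simp only [f, Sigma.mk.injEq, heq_eq_eq, true_and] at hab
    exact hab.1
  have hA : (Finset.univ.filter fun o : DeformIdx [[e, c₂, c₃, c₄, e, b₂, b₃, b₄]] => o.2.2.1 = if (o.2.1 : ℕ) < 4 then q else p)
      = Finset.univ.map ⟨f, hf⟩ := by
    ext o
    simp only [Finset.mem_filter, Finset.mem_univ, true_and, Finset.mem_map, Function.Embedding.coeFn_mk]
    constructor
    · intro ho
      obtain ⟨y, q', hq', rfl⟩ := deformIdx_elim o
      have ho' : q' = if (y : ℕ) < 4 then q else p := ho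
      subst ho'
      exact ⟨y, rfl⟩
    · rintro ⟨y, rfl⟩
      rfl
  -- the two secondary terms at the `e`-locations
  have hB : (Finset.univ.filter fun o : DeformIdx [[e, c₂, c₃, c₄, e, b₂, b₃, b₄]] =>
      ((o.2.1 : ℕ) = 0 ∨ (o.2.1 : ℕ) = 4) ∧ o.2.2.1 = if (o.2.1 : ℕ) < 4 then p else q).card = 2 := by
    refine Finset.card_eq_two.2 ⟨⟨⟨0, Nat.zero_lt_one⟩, ⟨0, by simp⟩, ⟨p, hP.mem_plaquettesAt (by simp)⟩⟩,
      ⟨⟨0, Nat.zero_lt_one⟩, ⟨4, by simp⟩, ⟨q, hQ.mem_plaquettesAt (by simp)⟩⟩,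
      ne_of_apply_ne (fun o : DeformIdx [[e, c₂, c₃, c₄, e, b₂, b₃, b₄]] => (o.2.1 : ℕ)) (by simp), ?_⟩
    ext o
    simp only [Finset.mem_filter, Finset.mem_univ, true_and, Finset.mem_insert, Finset.mem_singleton]
    constructor
    · intro h
      obtain ⟨⟨y, hy⟩, q', hq', rfl⟩ := deformIdx_elim o
      dsimp only at h
      rcases h with ⟨rfl | rfl, hq⟩
      · have hq0 : q' = p := by simpa using hq
        subst hq0
        exact Or.inl rfl
      · have hq4 : q' = q := by simpa using hq
        subst hq4
        exact Or.inr rfl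
    · rintro (rfl | rfl)
      · exact ⟨Or.inl rfl, rfl⟩
      · exact ⟨Or.inr rfl, rfl⟩
  rw [hA, hB, Finset.card_map, Finset.card_univ, Fintype.card_fin]
  norm_num

/-- `Σ_{𝔻⁺((w₈))} a₁ = 0`. [cite: Chatterjee2019LargeN, Corollary 10.4 (k = 2 for w₈)] -/
theorem sum_pos_w8 (hP : IsUnitLoop p [e, b₂, b₃, b₄]) (hQ : IsUnitLoop q [e, c₂, c₃, c₄]) (hpq : p ≠ q) :
    ∑ o : DeformIdx [[e, c₂, c₃, c₄, e, b₂, b₃, b₄]], coeffA (LoopSeq.posDeformAt [[e, c₂, c₃, c₄, e, b₂, b₃, b₄]] o) 1 = 0 := by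
  refine Finset.sum_eq_zero fun o _ => ?_
  obtain ⟨y, q', hq', rfl⟩ := deformIdx_elim o
  exact eval_pos_w8 hP hQ hpq y q' hq'

/-- ★ **`a₂(∂p ⊕ q) = 1`**: `8·a₂(w₈) = 0 − 2 + (10 − 0)`. [cite: Chatterjee2019LargeN, Corollary 10.4, §4] -/
theorem coeffA_w8_two (hP : IsUnitLoop p [e, b₂, b₃, b₄]) (hQ : IsUnitLoop q [e, c₂, c₃, c₄]) (hpq : p ≠ q) :
    coeffA [[e, c₂, c₃, c₄, e, b₂, b₃, b₄]] 2 = 1 := by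
  classical
  have h := Factorization.len_mul_coeffA (s := [[e, c₂, c₃, c₄, e, b₂, b₃, b₄]]) (List.cons_ne_nil _ _) (by simp [LoopSeq.len]) 2
  haveI : IsEmpty (InvIdx [[e, c₂, c₃, c₄, e, b₂, b₃, b₄]]) := invIdx_isEmpty (letters_w8 hP hQ hpq)
  rw [Fintype.sum_empty, if_pos one_le_two, sum_same_w8 hP hQ hpq, sum_neg_w8 hP hQ hpq,
    sum_pos_w8 hP hQ hpq] at h
  have hl : (LoopSeq.len [[e, c₂, c₃, c₄, e, b₂, b₃, b₄]] : ℝ) = 8 := by simp [LoopSeq.len]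
  rw [hl] at h
  linarith

/-! ### `a₂(V V) = 0`: the doubled loop `V V = ∂p ⊕ p` -/

/-- Splittings only see the loop read from the first location and the cyclic gap to the second.
[cite: Chatterjee2019LargeN, §2.2 (positive splitting)] -/
theorem posSplit_eq_of_rotate_eq {w w' : Word d} {x y : Fin w.length} {x' y' : Fin w'.length}
    (h : w.rotate x = w'.rotate x') (hg : Word.gap w x y = Word.gap w' x' y') :
    Word.posSplit₁ w x y = Word.posSplit₁ w' x' y' ∧ Word.posSplit₂ w x y = Word.posSplit₂ w' x' y' := by
  have h1 := Word.rotate_eq_letter_cons_drop w x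
  have h2 := Word.rotate_eq_letter_cons_drop w' x'
  have hl : w.letter x = w'.letter x' := (List.cons.inj (h1.symm.trans (h.trans h2))).1
  simp only [Word.posSplit₁, Word.posSplit₂, Word.arcAfter, Word.arcBetween, h, hg, hl, and_self]

/-- No letter of `V V` occurs inverted (so `𝕊⁻((V V)) = ∅`). [cite: Chatterjee2019LargeN, §2.2 (𝕊⁻(s))] -/
theorem letters_double {f g₂ g₃ g₄ : DEdge d} (hV : IsUnitLoop p [f, g₂, g₃, g₄]) :
    ∀ a ∈ [f, g₂, g₃, g₄, f, g₂, g₃, g₄], DEdge.inv a ∉ [f, g₂, g₃, g₄, f, g₂, g₃, g₄] := by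
  obtain ⟨⟨h12, h13, h14⟩, ⟨h23, h24⟩, h34⟩ := fst_ne_of_unit hV
  intro a ha
  simp only [List.mem_cons, List.not_mem_nil, or_false] at ha
  rcases ha with rfl | rfl | rfl | rfl | rfl | rfl | rfl | rfl <;>
    simp [DEdge.inv, Prod.ext_iff, h12, h13, h14, h23, h24, h34, h12.symm, h13.symm, h14.symm, h23.symm,
      h24.symm, h34.symm]

/-- The antipodal location `x ± 4` of `V V` is a location. [cite: Chatterjee2019LargeN, §2.1 (locations in a cycle)] -/
theorem double_bound {f g₂ g₃ g₄ : DEdge d} (x : Fin [f, g₂, g₃, g₄, f, g₂, g₃, g₄].length) :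
    (if (x : ℕ) < 4 then (x : ℕ) + 4 else (x : ℕ) - 4) < [f, g₂, g₃, g₄, f, g₂, g₃, g₄].length := by
  simp only [List.length_cons, List.length_nil]; split_ifs <;> omega

/-- The antipodal location `x ± 4` of `V V` carries the same letter. [cite: Chatterjee2019LargeN, §2.2 (𝕊⁺(s))] -/
theorem double_pair {f g₂ g₃ g₄ : DEdge d} (x : Fin [f, g₂, g₃, g₄, f, g₂, g₃, g₄].length) :
    x ≠ ⟨_, double_bound x⟩ ∧ [f, g₂, g₃, g₄, f, g₂, g₃, g₄].get ⟨_, double_bound x⟩ = [f, g₂, g₃, g₄, f, g₂, g₃, g₄].get x := by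
  obtain ⟨x, hx⟩ := x
  have hx8 : x < 8 := by simpa using hx
  interval_cases x <;> exact ⟨by simp [Fin.ext_iff], rfl⟩

/-- `𝕊⁺((V V))` consists of the `8` antipodal pairs `(x, x + 4)`, each splitting `V V` into two unit loops
of `p`. [cite: Chatterjee2019LargeN, §2.2 (positive splitting), §4] -/
theorem sameIdx_double {f g₂ g₃ g₄ : DEdge d} (hV : IsUnitLoop p [f, g₂, g₃, g₄]) :
    ∃ g : Fin [f, g₂, g₃, g₄, f, g₂, g₃, g₄].length → SameIdx [[f, g₂, g₃, g₄, f, g₂, g₃, g₄]], Function.Bijective g ∧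
      ∀ x, ∃ u₁ u₂, IsUnitLoop p u₁ ∧ IsUnitLoop p u₂ ∧ LoopSeq.posSplitAt [[f, g₂, g₃, g₄, f, g₂, g₃, g₄]] (g x) = [u₁, u₂] := by
  obtain ⟨⟨h12, h13, h14⟩, ⟨h23, h24⟩, h34⟩ := fst_ne_of_unit hV
  refine ⟨fun x => ⟨⟨0, Nat.zero_lt_one⟩, ⟨(x, ⟨_, double_bound x⟩), double_pair x⟩⟩,
    ⟨?_, ?_⟩, ?_⟩
  · intro a b hab
    simp only [Sigma.mk.injEq, heq_eq_eq, true_and, Subtype.mk.injEq, Prod.mk.injEq] at hab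
    exact hab.1
  · intro o
    obtain ⟨⟨x, hx⟩, ⟨y, hy⟩, ⟨hxy, hget⟩, rfl⟩ := sameIdx_elim o
    refine ⟨⟨x, hx⟩, ?_⟩
    have hl := hget
    simp only [List.get_eq_getElem] at hl
    have hx8 : x < 8 := by simpa using hx
    have hy8 : y < 8 := by simpa using hy
    interval_cases x <;> interval_cases y <;>
      simp only [List.getElem_cons_zero, List.getElem_cons_succ] at hl <;>
      first
        | exact (hxy rfl).elim
        | rfl
        | exact absurd (congrArg Prod.fst hl) (by assumption)
        | exact absurd (congrArg Prod.fst hl).symm (by assumption)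
  · have key : ∀ {f' g₂' g₃' g₄' : DEdge d} (_ : IsUnitLoop p [f', g₂', g₃', g₄']) (y y4 : Fin [f, g₂, g₃, g₄, f, g₂, g₃, g₄].length)
        (_ : [f, g₂, g₃, g₄, f, g₂, g₃, g₄].rotate (y : ℕ) = [f', g₂', g₃', g₄', f', g₂', g₃', g₄'].rotate ((⟨0, by simp⟩ : Fin [f', g₂', g₃', g₄', f', g₂', g₃', g₄'].length) : ℕ))
        (_ : Word.gap [f, g₂, g₃, g₄, f, g₂, g₃, g₄] y y4 = Word.gap [f', g₂', g₃', g₄', f', g₂', g₃', g₄'] ⟨0, by simp⟩ ⟨4, by simp⟩),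
        ∃ u₁ u₂, IsUnitLoop p u₁ ∧ IsUnitLoop p u₂ ∧
          LoopSeq.replaceAt [[f, g₂, g₃, g₄, f, g₂, g₃, g₄]] 0 [Word.posSplit₁ [f, g₂, g₃, g₄, f, g₂, g₃, g₄] y y4, Word.posSplit₂ [f, g₂, g₃, g₄, f, g₂, g₃, g₄] y y4] = [u₁, u₂] := by
      intro f' g₂' g₃' g₄' hV' y y4 hr hg
      obtain ⟨h1, h2⟩ := posSplit_eq_of_rotate_eq hr hg
      rw [h1, h2, (posSplit_double_04 hV').1, (posSplit_double_04 hV').2]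
      exact ⟨_, _, hV', unit_rot1 hV', replaceAt_singleton_zero_pair _ _ _ hV'.ne_nil (unit_rot1 hV').ne_nil⟩
    have hg : ∀ (y y4 : Fin [f, g₂, g₃, g₄, f, g₂, g₃, g₄].length), (8 - (y : ℕ) + (y4 : ℕ)) % 8 = 4 →
        ∀ {f' g₂' g₃' g₄' : DEdge d}, Word.gap [f, g₂, g₃, g₄, f, g₂, g₃, g₄] y y4 = Word.gap [f', g₂', g₃', g₄', f', g₂', g₃', g₄'] ⟨0, by simp⟩ ⟨4, by simp⟩ := by
      intro y y4 h f' g₂' g₃' g₄'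
      rw [(gap_04 [f', g₂', g₃', g₄', f', g₂', g₃', g₄'] rfl).1, Word.gap, Fin.sub_def]
      simpa using h
    have h1 := unit_rot1 hV
    have h2 := unit_rot1 h1
    have h3 := unit_rot1 h2
    intro x
    obtain ⟨x, hx⟩ := x
    have hx8 : x < 8 := by simpa using hx
    interval_cases x
    · exact key hV _ _ rfl (hg _ _ (by simp))
    · exact key h1 _ _ rfl (hg _ _ (by simp))
    · exact key h2 _ _ rfl (hg _ _ (by simp))
    · exact key h3 _ _ rfl (hg _ _ (by simp))
    · exact key hV _ _ rfl (hg _ _ (by simp))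
    · exact key h1 _ _ rfl (hg _ _ (by simp))
    · exact key h2 _ _ rfl (hg _ _ (by simp))
    · exact key h3 _ _ rfl (hg _ _ (by simp))

/-- `Σ_{𝕊⁺((V V))} a₂ = 8`. [cite: Chatterjee2019LargeN, Corollary 10.4, Lemma 11.3, §4] -/
theorem sum_same_double {f g₂ g₃ g₄ : DEdge d} (hV : IsUnitLoop p [f, g₂, g₃, g₄]) :
    ∑ o : SameIdx [[f, g₂, g₃, g₄, f, g₂, g₃, g₄]], coeffA (LoopSeq.posSplitAt [[f, g₂, g₃, g₄, f, g₂, g₃, g₄]] o) 2 = 8 := by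
  classical
  obtain ⟨g, hg, hval⟩ := sameIdx_double hV
  rw [← (Equiv.ofBijective g hg).sum_comp]
  have h1 : ∀ x, coeffA (LoopSeq.posSplitAt [[f, g₂, g₃, g₄, f, g₂, g₃, g₄]] ((Equiv.ofBijective g hg) x)) 2 = 1 := by
    intro x
    obtain ⟨u₁, u₂, hu₁, hu₂, h⟩ := hval x
    rw [Equiv.ofBijective_apply, h]
    exact coeffA_pair_two hu₁ hu₂
  rw [Finset.sum_congr rfl fun x _ => h1 x, Finset.sum_const, Finset.card_univ, Fintype.card_fin]
  simp

/-- The negative-deformation terms for `V V` at order `2`: `V V ⊖ₓ p` is a unit loop of `p` (`a₁ = 1`) at every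
location, and `V V ⊖ₓ q'`, `q' ≠ p`, has the non-unit 1-chain `2r(V) ± δq'`. [cite: Chatterjee2019LargeN, Corollary 10.4, §14] -/
theorem eval_neg_double {f g₂ g₃ g₄ : DEdge d} (hV : IsUnitLoop p [f, g₂, g₃, g₄]) (y : Fin [f, g₂, g₃, g₄, f, g₂, g₃, g₄].length)
    (q' : ZdPlaquette d) (hq' : q' ∈ plaquettesAt ([f, g₂, g₃, g₄, f, g₂, g₃, g₄].get y)) :
    coeffA (LoopSeq.replaceAt [[f, g₂, g₃, g₄, f, g₂, g₃, g₄]] 0 [Word.negDeform [f, g₂, g₃, g₄, f, g₂, g₃, g₄] y q']) 1 = if q' = p then 1 else 0 := by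
  classical
  obtain ⟨τ, hτ, hc⟩ := hV.wordChain_eq
  have hch : wordChain [f, g₂, g₃, g₄, f, g₂, g₃, g₄] = (2 * τ) • plaquetteChain p := by
    rw [show [f, g₂, g₃, g₄, f, g₂, g₃, g₄] = [f, g₂, g₃, g₄] ++ [f, g₂, g₃, g₄] from rfl, wordChain_append, hc, two_mul, add_smul]
  have hloop := isLoop_double hV
  by_cases hqp : q' = p
  · rw [if_pos hqp, hqp]
    have key : ∀ {f' g₂' g₃' g₄' : DEdge d} (_ : IsUnitLoop p [f', g₂', g₃', g₄'])
        (_ : [f, g₂, g₃, g₄, f, g₂, g₃, g₄].rotate (y : ℕ) = [f', g₂', g₃', g₄', f', g₂', g₃', g₄'].rotate ((⟨0, by simp⟩ : Fin [f', g₂', g₃', g₄', f', g₂', g₃', g₄'].length) : ℕ)),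
        coeffA (LoopSeq.replaceAt [[f, g₂, g₃, g₄, f, g₂, g₃, g₄]] 0 [Word.negDeform [f, g₂, g₃, g₄, f, g₂, g₃, g₄] y p]) 1 = 1 := by
      intro f' g₂' g₃' g₄' hV' hr
      rw [negDeform_eq_of_rotate_eq hr, negDeform_double_0 hV', coeffA_replaceAt_one_eq_one hV']
    have h1 := unit_rot1 hV
    have h2 := unit_rot1 h1
    have h3 := unit_rot1 h2
    obtain ⟨y, hy⟩ := y
    have hy8 : y < 8 := by simpa using hy
    interval_cases y
    · exact key hV rfl
    · exact key h1 rfl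
    · exact key h2 rfl
    · exact key h3 rfl
    · exact key hV rfl
    · exact key h1 rfl
    · exact key h2 rfl
    · exact key h3 rfl
  · rw [if_neg hqp]
    refine coeffA_replaceAt_one_eq_zero (Word.isLoop_negDeform hloop.1 y hq') fun q'' ρ hρ hc' => ?_
    obtain ⟨σ, hσ, hσc⟩ := Word.wordChain_negDeform _ y hq'
    rw [hσc, hch] at hc'
    exact hqp (eq_of_chain_double hτ hσ hρ hc')

/-- All positive-deformation terms for `V V` at order `2` vanish (1-chains `3r(V)` or `2r(V) ± δq'`).
[cite: Chatterjee2019LargeN, Corollary 10.4, §14] -/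
theorem eval_pos_double {f g₂ g₃ g₄ : DEdge d} (hV : IsUnitLoop p [f, g₂, g₃, g₄]) (y : Fin [f, g₂, g₃, g₄, f, g₂, g₃, g₄].length)
    (q' : ZdPlaquette d) (hq' : q' ∈ plaquettesAt ([f, g₂, g₃, g₄, f, g₂, g₃, g₄].get y)) :
    coeffA (LoopSeq.replaceAt [[f, g₂, g₃, g₄, f, g₂, g₃, g₄]] 0 [Word.posDeform [f, g₂, g₃, g₄, f, g₂, g₃, g₄] y q']) 1 = 0 := by
  classical
  obtain ⟨τ, hτ, hc⟩ := hV.wordChain_eq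
  have hch : wordChain [f, g₂, g₃, g₄, f, g₂, g₃, g₄] = (2 * τ) • plaquetteChain p := by
    rw [show [f, g₂, g₃, g₄, f, g₂, g₃, g₄] = [f, g₂, g₃, g₄] ++ [f, g₂, g₃, g₄] from rfl, wordChain_append, hc, two_mul, add_smul]
  have hloop := isLoop_double hV
  refine coeffA_replaceAt_one_eq_zero (Word.isLoop_posDeform hloop.1 y hq') fun q'' ρ hρ hc' => ?_
  by_cases hqp : q' = p
  · have key : ∀ (t : Word d) (j : Fin [f, g₂, g₃, g₄].length),
        [f, g₂, g₃, g₄, f, g₂, g₃, g₄].rotate y = [f, g₂, g₃, g₄].get j :: t → False := by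
      intro t j hrot
      rw [hqp, hV.wordChain_posDeform j y hrot, hch, hc, ← add_smul, show 2 * τ + τ = 3 * τ by ring] at hc'
      exact chain_ne_of_triple hτ hρ hc'
    obtain ⟨y, hy⟩ := y
    have hy8 : y < 8 := by simpa using hy
    interval_cases y
    · exact key [g₂, g₃, g₄, f, g₂, g₃, g₄] ⟨0, by simp⟩ rfl
    · exact key [g₃, g₄, f, g₂, g₃, g₄, f] ⟨1, by simp⟩ rfl
    · exact key [g₄, f, g₂, g₃, g₄, f, g₂] ⟨2, by simp⟩ rfl
    · exact key [f, g₂, g₃, g₄, f, g₂, g₃] ⟨3, by simp⟩ rfl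
    · exact key [g₂, g₃, g₄, f, g₂, g₃, g₄] ⟨0, by simp⟩ rfl
    · exact key [g₃, g₄, f, g₂, g₃, g₄, f] ⟨1, by simp⟩ rfl
    · exact key [g₄, f, g₂, g₃, g₄, f, g₂] ⟨2, by simp⟩ rfl
    · exact key [f, g₂, g₃, g₄, f, g₂, g₃] ⟨3, by simp⟩ rfl
  · obtain ⟨σ, hσ, hσc⟩ := Word.wordChain_posDeform _ y hq'
    rw [hσc, hch] at hc'
    exact hqp (eq_of_chain_double hτ hσ hρ hc')

/-- `Σ_{𝔻⁻((V V))} a₁ = 8`. [cite: Chatterjee2019LargeN, Corollary 10.4 (k = 2 for V V)] -/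
theorem sum_neg_double {f g₂ g₃ g₄ : DEdge d} (hV : IsUnitLoop p [f, g₂, g₃, g₄]) :
    ∑ o : DeformIdx [[f, g₂, g₃, g₄, f, g₂, g₃, g₄]], coeffA (LoopSeq.negDeformAt [[f, g₂, g₃, g₄, f, g₂, g₃, g₄]] o) 1 = 8 := by
  classical
  have hpt : ∀ o : DeformIdx [[f, g₂, g₃, g₄, f, g₂, g₃, g₄]], coeffA (LoopSeq.negDeformAt [[f, g₂, g₃, g₄, f, g₂, g₃, g₄]] o) 1 = if o.2.2.1 = p then 1 else 0 := by
    intro o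
    obtain ⟨y, q', hq', rfl⟩ := deformIdx_elim o
    exact eval_neg_double hV y q' hq'
  rw [Finset.sum_congr rfl fun o _ => hpt o, Finset.sum_boole]
  have hmem : ∀ y : Fin [f, g₂, g₃, g₄, f, g₂, g₃, g₄].length, p ∈ plaquettesAt ([f, g₂, g₃, g₄, f, g₂, g₃, g₄].get y) := by
    rintro ⟨y, hy⟩
    have hy8 : y < 8 := by simpa using hy
    interval_cases y <;> exact hV.mem_plaquettesAt (by simp)
  let g : Fin [f, g₂, g₃, g₄, f, g₂, g₃, g₄].length → DeformIdx [[f, g₂, g₃, g₄, f, g₂, g₃, g₄]] := fun y => ⟨⟨0, Nat.zero_lt_one⟩, y, ⟨p, hmem y⟩⟩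
  have hg : Function.Injective g := by
    intro a b hab
    simp only [g, Sigma.mk.injEq, heq_eq_eq, true_and] at hab
    exact hab.1
  have hset : (Finset.univ.filter fun o : DeformIdx [[f, g₂, g₃, g₄, f, g₂, g₃, g₄]] => o.2.2.1 = p) = Finset.univ.map ⟨g, hg⟩ := by
    ext o
    simp only [Finset.mem_filter, Finset.mem_univ, true_and, Finset.mem_map, Function.Embedding.coeFn_mk]
    constructor
    · intro ho
      obtain ⟨y, q', hq', rfl⟩ := deformIdx_elim o
      have ho' : q' = p := ho
      subst ho'
      exact ⟨y, rfl⟩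
    · rintro ⟨y, rfl⟩
      rfl
  rw [hset, Finset.card_map, Finset.card_univ, Fintype.card_fin]
  norm_num

/-- `Σ_{𝔻⁺((V V))} a₁ = 0`. [cite: Chatterjee2019LargeN, Corollary 10.4 (k = 2 for V V)] -/
theorem sum_pos_double {f g₂ g₃ g₄ : DEdge d} (hV : IsUnitLoop p [f, g₂, g₃, g₄]) :
    ∑ o : DeformIdx [[f, g₂, g₃, g₄, f, g₂, g₃, g₄]], coeffA (LoopSeq.posDeformAt [[f, g₂, g₃, g₄, f, g₂, g₃, g₄]] o) 1 = 0 := by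
  refine Finset.sum_eq_zero fun o _ => ?_
  obtain ⟨y, q', hq', rfl⟩ := deformIdx_elim o
  exact eval_pos_double hV y q' hq'

/-- ★ **`a₂(∂p ⊕ p) = 0`**: `8·a₂(V V) = 0 − 8 + (8 − 0)` — the eight splittings into two unit loops cancel the
eight negative deformations back to a unit loop. [cite: Chatterjee2019LargeN, Corollary 10.4, §4] -/
theorem coeffA_double_two {f g₂ g₃ g₄ : DEdge d} (hV : IsUnitLoop p [f, g₂, g₃, g₄]) : coeffA [[f, g₂, g₃, g₄, f, g₂, g₃, g₄]] 2 = 0 := by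
  classical
  have h := Factorization.len_mul_coeffA (s := [[f, g₂, g₃, g₄, f, g₂, g₃, g₄]]) (List.cons_ne_nil _ _) (by simp [LoopSeq.len]) 2
  haveI : IsEmpty (InvIdx [[f, g₂, g₃, g₄, f, g₂, g₃, g₄]]) := invIdx_isEmpty (letters_double hV)
  rw [Fintype.sum_empty, if_pos one_le_two, sum_same_double hV, sum_neg_double hV, sum_pos_double hV] at h
  have hl : (LoopSeq.len [[f, g₂, g₃, g₄, f, g₂, g₃, g₄]] : ℝ) = 8 := by simp [LoopSeq.len]
  rw [hl] at h
  linarith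

end TwoPlaquettes

/-! ### From a deformation index of `(∂p)` to the two-plaquette configuration -/

/-- No letter of a unit loop occurs inverted in it (so `𝕊⁻((∂p)) = ∅`). [cite: Chatterjee2019LargeN, §2.1 (∂p is a loop), §2.2 (𝕊⁻(s))] -/
theorem inv_not_mem_of_unit {q : ZdPlaquette d} {u : Word d} (h : IsUnitLoop q u) : ∀ a ∈ u, DEdge.inv a ∉ u := by
  intro a ha hia
  exact DEdge.inv_ne_self a (h.eq_of_fst_eq hia ha rfl)

/-- A plaquette `q' ∈ 𝒫⁺(e)` has a unit loop STARTING with the letter `e` itself (rotate `∂q'` or `(∂q')⁻¹`).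
[cite: Chatterjee2019LargeN, §2.2 (the unique location of e or e⁻¹ in ∂q')] -/
theorem exists_unit_cons {q' : ZdPlaquette d} {e : DEdge d} (h : q' ∈ plaquettesAt e) :
    ∃ c₂ c₃ c₄ : DEdge d, IsUnitLoop q' [e, c₂, c₃, c₄] := by
  obtain ⟨a, d', hrot, ha⟩ := Word.rotate_plaquetteLoc_eq_cons h
  have hU : IsUnitLoop q' (a :: d') := ⟨_, Or.inl hrot.symm⟩
  have hlen : d'.length = 3 := by
    have := hU.length_eq
    simp only [List.length_cons] at this
    omega
  obtain ⟨c₂, c₃, c₄, rfl⟩ := List.length_eq_three.1 hlen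
  rw [show a = (e.1, a.2) from Prod.ext ha rfl] at hU
  by_cases hb : a.2 = e.2
  · rw [hb, Prod.mk.eta] at hU
    exact ⟨c₂, c₃, c₄, hU⟩
  · have hb' : a.2 = !e.2 := by cases h1 : a.2 <;> cases h2 : e.2 <;> simp_all
    rw [hb'] at hU
    refine ⟨DEdge.inv c₄, DEdge.inv c₃, DEdge.inv c₂, ?_⟩
    have h3 := hU.invRev.rotate 3
    rwa [invRev_four, show DEdge.inv (e.1, !e.2) = e by simp [DEdge.inv],
      show [DEdge.inv c₄, DEdge.inv c₃, DEdge.inv c₂, e].rotate 3 = [e, DEdge.inv c₄, DEdge.inv c₃, DEdge.inv c₂]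
        from rfl] at h3

/-- **The order-`2` terms of the first-move recursion for `(∂p)` cancel pairwise**: for every location `x` of `∂p`
and every `q' ∈ 𝒫⁺(e_x)`, `a₂((∂p ⊖ₓ q')) = a₂((∂p ⊕ₓ q'))` — both `0` for `q' = p` (`∅` and `V V`), both `1`
for `q' ≠ p` (`w₆` and `w₈`). [cite: Chatterjee2019LargeN, Corollary 10.4 (k = 3 for (∂p)), §4] -/
theorem deform_terms_cancel (p : ZdPlaquette d) (o : DeformIdx [plaquetteWord p]) :
    coeffA (LoopSeq.negDeformAt [plaquetteWord p] o) 2 = coeffA (LoopSeq.posDeformAt [plaquetteWord p] o) 2 := by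
  classical
  have hU := IsUnitLoop.plaquetteWord p
  obtain ⟨x, q', hq', rfl⟩ := deformIdx_elim o
  have h1 := Word.rotate_eq_letter_cons_drop (plaquetteWord p) x
  have hlen : (((plaquetteWord p).rotate (x : ℕ)).drop 1).length = 3 := by
    simp [length_plaquetteWord]
  obtain ⟨b₂, b₃, b₄, h3⟩ := List.length_eq_three.1 hlen
  rw [h3] at h1
  have hP : IsUnitLoop p [(plaquetteWord p).get x, b₂, b₃, b₄] := by
    have := hU.rotate x
    rw [h1] at this
    exact this
  have hr : (plaquetteWord p).rotate (x : ℕ) = [(plaquetteWord p).get x, b₂, b₃, b₄].rotate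
      ((⟨0, by simp⟩ : Fin [(plaquetteWord p).get x, b₂, b₃, b₄].length) : ℕ) := h1
  change coeffA (LoopSeq.replaceAt [plaquetteWord p] 0 [Word.negDeform (plaquetteWord p) x q']) 2 =
    coeffA (LoopSeq.replaceAt [plaquetteWord p] 0 [Word.posDeform (plaquetteWord p) x q']) 2
  rw [negDeform_eq_of_rotate_eq hr, posDeform_eq_of_rotate_eq hr, replaceAt_singleton_zero,
    replaceAt_singleton_zero]
  by_cases hq : q' = p
  · rw [hq, hP.negDeform_self ⟨0, by simp⟩, if_pos rfl, posDeform_V_p hP, if_neg (List.cons_ne_nil _ _),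
      coeffA_nil_of_pos (by norm_num), coeffA_double_two hP]
  · obtain ⟨c₂, c₃, c₄, hQ⟩ := exists_unit_cons hq'
    rw [negDeform_P_q hP hQ (Ne.symm hq), posDeform_P_q hP hQ (Ne.symm hq), if_neg (List.cons_ne_nil _ _),
      if_neg (List.cons_ne_nil _ _), coeffA_w6_two hP hQ (Ne.symm hq), coeffA_w8_two hP hQ (Ne.symm hq)]

end PlaquetteThirdOrderProof

open PlaquetteThirdOrderProof in
/-- ★ **`a₃((p)) = 0` for every plaquette `p`, in every dimension** — the `k = 3` entry of §4's list
«`a₀ = 0, a₁ = 1, a₂ = 0, a₃ = 0, a₄ = 0`» — from the first-move recursion (Corollary 10.4) at `k = 3`: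
`4·a₃((∂p)) = Σ_{𝕊⁻} − Σ_{𝕊⁺} + Σ_{(x,q')} [a₂((∂p ⊖ₓ q')) − a₂((∂p ⊕ₓ q'))] = 0 − 0 + Σ 0`.
[cite: Chatterjee2019LargeN, §4 (last paragraph: a₃ = 0); Corollary 10.4] -/
theorem coeffA_plaquette_three (p : ZdPlaquette d) : coeffA [plaquetteWord p] 3 = 0 := by
  classical
  have hU := IsUnitLoop.plaquetteWord p
  have h := Factorization.len_mul_coeffA (s := [plaquetteWord p]) (List.cons_ne_nil _ _)
    (by simp [LoopSeq.len, length_plaquetteWord]) 3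
  haveI : IsEmpty (InvIdx [plaquetteWord p]) := invIdx_isEmpty (inv_not_mem_of_unit hU)
  haveI : IsEmpty (SameIdx [plaquetteWord p]) := sameIdx_isEmpty hU.nodup
  rw [Fintype.sum_empty, Fintype.sum_empty, if_pos (by norm_num : 1 ≤ 3),
    Finset.sum_congr rfl fun o _ => deform_terms_cancel p o, sub_self, sub_self, zero_add] at h
  have hl : (LoopSeq.len [plaquetteWord p] : ℝ) = 4 := by simp [LoopSeq.len, length_plaquetteWord]
  rw [hl] at h
  linarith

/-- The `k = 3` row of the printed table (`PlaquetteCoefficientsZ3`): `a₃((p)) = 0` for a plaquette of `ℤ³`.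
[cite: Chatterjee2019LargeN, §4 (last paragraph: a₃ = 0)] -/
theorem plaquetteCoefficientsZ3_three (p : ZdPlaquette 3) : coeffA [plaquetteWord p] 3 = (plaquetteCoeffZ3 3 : ℝ) := by
  rw [coeffA_plaquette_three]
  simp [plaquetteCoeffZ3]

/-- **Rows `k ≤ 4` of the printed table** «`a₀ = 0, a₁ = 1, a₂ = 0, a₃ = 0, a₄ = 0`»: `PlaquetteCoefficientsZ3` restricted to
`k < 5` is a theorem (rows `0, 1, 2, 4` by `AreaLowerBound`, `PlaquetteFirstOrder`, `AreaParity`; row `3` here).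
[cite: Chatterjee2019LargeN, §4 (last paragraph)] -/
theorem plaquetteCoefficientsZ3_of_lt_five (p : ZdPlaquette 3) {k : ℕ} (hk : k < 5) :
    coeffA [plaquetteWord p] k = (plaquetteCoeffZ3 k : ℝ) := by
  interval_cases k
  · exact plaquetteCoefficientsZ3_zero p
  · exact plaquetteCoefficientsZ3_one p
  · exact plaquetteCoefficientsZ3_two p
  · exact plaquetteCoefficientsZ3_three p
  · exact plaquetteCoefficientsZ3_four p

/-! ### v1.1: §4's display to the verified order — `lim ⟨W_p⟩/N = β + O(β⁵)` from Corollary 3.5 and rows `k ≤ 4` -/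

/-- **§4's last display to the order verified in the tree, in every dimension `d ≥ 2`**: Corollary 3.5
(`RealAnalyticityStrongCoupling`: `lim ⟨W_p⟩/N = Σ a_k((p)) β^k`, absolutely convergent for `|β| ≤ β₀(d)`) and the
theorems `a₀ = 0, a₁ = 1, a₂ = a₃ = a₄ = 0` (`coeffA_plaquette_zero/one/two/three/four`) give: there is `β₁ > 0`
and, for every plaquette `p`, a constant `C` such that for every exhaustion `Λ` and every `|β| ≤ β₁` the limit `f` of
`⟨W_p⟩_{Λ_N,N,β}/N` exists and `|f − β| ≤ C|β|⁵` (on `|β| ≤ β₀/2` the tail `Σ_{k≥5}` is at most `(2M/β₀⁵)|β|⁵`,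
`M = Σ_k |a_k| β₀^k`; same argument as `plaquetteExpansionZ3_of`). The printed `d = 3` display continues «`− 7β⁵ + O(β⁶)`»;
that term (row `k = 5` of `PlaquetteCoefficientsZ3`) is not used here.
[cite: Chatterjee2019LargeN, §4 (last paragraph and last display), Corollary 3.5 (first display)] -/
theorem plaquetteExpansion_order_five_of_realAnalyticity (hd : 2 ≤ d) (h1 : RealAnalyticityStrongCoupling d) :
    ∃ β₀ : ℝ, 0 < β₀ ∧ ∀ p : ZdPlaquette d, ∃ C : ℝ,
      ∀ Λ : ℕ → Finset (Literature.Probability.LatticeModels.Site d), IsExhaustion Λ →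
        ∀ β : ℝ, |β| ≤ β₀ →
          ∃ f : ℝ, Filter.Tendsto (fun N : ℕ => soExpect N β (Λ N) (wilsonLoopVar N (plaquetteWord p)) / N)
              Filter.atTop (nhds f) ∧ |f - β| ≤ C * |β| ^ 5 := by
  obtain ⟨β₀, hβ₀, H⟩ := h1 hd
  refine ⟨β₀ / 2, by positivity, fun p => ?_⟩
  set s : LoopSeq d := [plaquetteWord p] with hs_def
  have hs : IsLoopSeq s := isLoopSeq_plaquette p
  have hsne : s ≠ [] := List.cons_ne_nil _ _
  have hhead : ∀ β : ℝ, ∑ k ∈ Finset.range 5, coeffA s k * β ^ k = β := by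
    intro β
    simp only [Finset.sum_range_succ, Finset.sum_range_zero, hs_def, coeffA_plaquette_zero, coeffA_plaquette_one,
      coeffA_plaquette_two, coeffA_plaquette_three, coeffA_plaquette_four]
    ring
  by_cases hex : ∃ Λ₀ : ℕ → Finset (Literature.Probability.LatticeModels.Site d), IsExhaustion Λ₀
  swap
  · exact ⟨0, fun Λ hΛ => (hex ⟨Λ, hΛ⟩).elim⟩
  obtain ⟨Λ₀, hΛ₀⟩ := hex
  have hS0 : Summable (fun k : ℕ => coeffA s k * β₀ ^ k) :=
    (H Λ₀ hΛ₀ β₀ (by rw [abs_of_pos hβ₀]) s hs hsne).1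
  set g : ℕ → ℝ := fun k => |coeffA s k| * β₀ ^ k with hg_def
  have hg : Summable g := by
    refine hS0.abs.congr fun k => ?_
    simp [g, abs_mul, abs_pow, abs_of_pos hβ₀]
  have hg0 : ∀ k, 0 ≤ g k := fun k => by positivity
  set M : ℝ := ∑' k, g k with hM_def
  have hM0 : 0 ≤ M := tsum_nonneg hg0
  have hgM : ∀ k, g k ≤ M := fun k => hg.le_tsum k (fun j _ => hg0 j)
  refine ⟨2 * M / β₀ ^ 5, fun Λ hΛ β hβ => ?_⟩
  have hβ' : |β| ≤ β₀ := hβ.trans (by linarith)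
  obtain ⟨hsum, hlim⟩ := H Λ hΛ β hβ' s hs hsne
  refine ⟨∑' k, coeffA s k * β ^ k, ?_, ?_⟩
  · refine hlim.congr' (Filter.Eventually.of_forall fun N => ?_)
    simp only [hs_def, phi_singleton]
  have hsplit := hsum.sum_add_tsum_nat_add 5
  rw [hhead β] at hsplit
  have htail : (∑' k, coeffA s k * β ^ k) - β = ∑' j, coeffA s (j + 5) * β ^ (j + 5) := by
    linarith
  rw [htail]
  set r : ℝ := |β| / β₀ with hr_def
  have hr0 : 0 ≤ r := by positivity
  have hr : r ≤ 1 / 2 := by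
    rw [hr_def, div_le_iff₀ hβ₀]; linarith
  have hsum5 : Summable (fun j : ℕ => coeffA s (j + 5) * β ^ (j + 5)) := (summable_nat_add_iff 5).2 hsum
  have habs5 : Summable (fun j : ℕ => ‖coeffA s (j + 5) * β ^ (j + 5)‖) := hsum5.norm
  have hterm : ∀ j : ℕ, ‖coeffA s (j + 5) * β ^ (j + 5)‖ ≤ M * r ^ 5 * (1 / 2) ^ j := by
    intro j
    rw [Real.norm_eq_abs, abs_mul, abs_pow]
    have hβeq : |β| = β₀ * r := by rw [hr_def]; field_simp
    rw [hβeq, mul_pow, ← mul_assoc]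
    have h1' : |coeffA s (j + 5)| * β₀ ^ (j + 5) ≤ M := hgM (j + 5)
    have h2' : r ^ (j + 5) ≤ r ^ 5 * (1 / 2) ^ j := by
      rw [pow_add, mul_comm]
      exact mul_le_mul_of_nonneg_left (pow_le_pow_left₀ hr0 hr j) (by positivity)
    calc |coeffA s (j + 5)| * β₀ ^ (j + 5) * r ^ (j + 5)
        ≤ M * (r ^ 5 * (1 / 2) ^ j) := mul_le_mul h1' h2' (by positivity) hM0
      _ = M * r ^ 5 * (1 / 2) ^ j := by ring
  have hgeo : Summable (fun j : ℕ => M * r ^ 5 * (1 / 2 : ℝ) ^ j) :=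
    (summable_geometric_of_lt_one (by norm_num) (by norm_num)).mul_left _
  calc |∑' j, coeffA s (j + 5) * β ^ (j + 5)|
      = ‖∑' j, coeffA s (j + 5) * β ^ (j + 5)‖ := (Real.norm_eq_abs _).symm
    _ ≤ ∑' j, ‖coeffA s (j + 5) * β ^ (j + 5)‖ := norm_tsum_le_tsum_norm habs5
    _ ≤ ∑' j, M * r ^ 5 * (1 / 2 : ℝ) ^ j := habs5.tsum_le_tsum hterm hgeo
    _ = M * r ^ 5 * 2 := by
        rw [tsum_mul_left, tsum_geometric_of_lt_one (by norm_num) (by norm_num)]; norm_num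
    _ = 2 * M / β₀ ^ 5 * |β| ^ 5 := by
        rw [hr_def, div_pow]; field_simp

end Literature.MathematicalPhysics.QuantumFieldTheory.Chatterjee2019LargeN

end
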